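import Literature.NumberTheory.ConnesMoscovici2022.UVProlateSpectrumProofs
import Literature.NumberTheory.ConnesMoscovici2022.UVProlateDeficiencyODE
import Mathlib.Analysis.Distribution.AEEqOfIntegralContDiff
import Mathlib.Analysis.Calculus.BumpFunction.Normed
import Mathlib.Analysis.Calculus.BumpFunction.InnerProduct
import Mathlib.MeasureTheory.Measure.OpenPos
import Mathlib.MeasureTheory.Integral.DivergenceTheorem
import HarnessLib

/-!
# Connes–Moscovici 2022, Lemma 1.1 (deficiency indices `(4,4)`) — part B: the weak equation,
# classical representatives on the components, and Green's identity with the two jump terms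

LINE 1 — FRAMING. RH-FREE corpus literature (spectral theory of the prolate wave operator
`W_λ = −∂(λ² − x²)∂ + (2πλx)²` on `L²(ℝ)`; sequel row of the Connes–Consani corpus, no leaf / binder
role).  bears_on: LADDER-RH W-C/W-P.  WHAT THIS IS NOT: any claim about RH; nothing in this file
mentions `RiemannHypothesis` or bears on the truth of RH.

Theorems-only companion of `UVProlateSpectrum.lean`, second of the files discharging the named fact
`CM22_lemma_1_1` (**Lemma 1.1** of A. Connes, H. Moscovici, *The UV prolate spectrum matches the
zeros of zeta*, PNAS 119 (2022) [bib: `ConnesMoscovici2022`] = arXiv:2112.05500 Lemma 2.1, chunk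
p0004:L39–L48; the proof printed there is quoted in full in the header of
`UVProlateDeficiencyODE.lean`).  THIS FILE formalises two sentences of that proof:

* "Any `ξ ∈ Dom(W_max)` satisfying `Wξ = ±iξ` is a piecewise real analytic function … in the
  complement of the two regular singular points `±λ`": §3–§4, an eigenvector `ξ` of `W_max`
  (`W_max ξ = zξ`, any `z ∈ ℂ`) agrees a.e. on each component of `ℝ ∖ {±λ}` with a classical solution
  pair of `(p g′)′ = (q − z) g` (`exists_sol_ae_eq_of_eigen` on a side interval, by the
  du Bois-Reymond route of the tree's proof of Lemma 1.2 — `integral_deriv_mul_eq_of_mem_prolateMax_c`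
  — which, unlike interior elliptic regularity, needs no reality of `z`; then
  `exists_sol_Ioi/Iio/Ioo_ae_eq_of_eigen` on the whole components by the uniqueness of part A);
* "the fact that `Wξ ∈ L²(ℝ)` impl[ies] that the logarithmic singularities of `ξ` on the left and the
  right of `±λ` have to match" and "any solution of `Wξ = ±iξ` belongs to `Dom(W_max)`": §5–§7,
  the weak equation `∫ ξ (Wθ − zθ) = 0` of an eigenvector (`integral_mul_prolateWave_sub_eq_zero_of_eigen`),
  GREEN'S IDENTITY for a function that is a classical solution on the three components, square
  integrable, with one-sided limits `c` of `p g′` at `±λ` (`integral_mul_prolateWave_sub_eq_jumps`: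
  `∫ g (Wθ − zθ) = θ(λ)(c_{λ⁻} − c_{λ⁺}) + θ(−λ)(c_{−λ⁻} − c_{−λ⁺})`), and the converse membership
  `mem_eigenspace_of_integral_eq_zero` (Mathlib `LinearPMap.mem_adjoint_domain_of_exists`).

§1–§2a are a private toolkit (smooth bumps, the du Bois-Reymond lemmas on an open interval, the
weak identities of `dom W_max`, Fubini against a bump, local integrability of `qξ − W_max ξ`, and the
side-interval first-order equation `p ξ′ = F + m`) copied VERBATIM from the tree's
`UVProlateBoundaryFunctional.lean` (rh-crit-cc-t8 g2; private there, or public there and private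
here: that module's olean was unavailable on the farm during a build-queue outage when this file was
written, so it is not imported — the copies can be replaced by the import later without touching any
public statement below).  0 `def`s, 0 new facts, no `sorry`.
-/

noncomputable section

open Complex Set MeasureTheory Filter SchwartzMap
open scoped Real Topology FourierTransform ENNReal InnerProductSpace ContDiff ComplexConjugate

namespace Literature.NumberTheory.ConnesMoscovici2022

open Literature.NumberTheory.ConnesConsani2021 Literature.NumberTheory.ConnesConsani2024

/-! ## §1. Private toolkit: test functions on an open interval and the du Bois-Reymond lemma
(copied from `UVProlateBoundaryFunctional.lean`, where these are private) -/

section TestFunctions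

variable {α β : ℝ}

/-- A smooth bump with integral `1` supported inside `(α, β)`. [folklore] -/
private theorem exists_smooth_bump (hαβ : α < β) :
    ∃ φ : ℝ → ℝ, ContDiff ℝ ∞ φ ∧ HasCompactSupport φ ∧ tsupport φ ⊆ Ioo α β ∧
      (∫ x, φ x) = 1 := by
  have hr : 0 < (β - α) / 4 := by linarith
  let b : ContDiffBump ((α + β) / 2) := ⟨(β - α) / 8, (β - α) / 4, by linarith, by linarith⟩
  refine ⟨b.normed volume, b.contDiff_normed, b.hasCompactSupport_normed, ?_, b.integral_normed⟩
  rw [b.tsupport_normed_eq]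
  intro x hx
  rw [Metric.mem_closedBall, Real.dist_eq, abs_le] at hx
  change -((β - α) / 4) ≤ x - (α + β) / 2 ∧ x - (α + β) / 2 ≤ (β - α) / 4 at hx
  constructor <;> [linarith [hx.1]; linarith [hx.2]]

/-- A compact subset of an open interval lies in a compact subinterval. [folklore] -/
private theorem exists_Icc_of_tsupport_subset {g : ℝ → ℝ} (hαβ : α < β) (hgc : HasCompactSupport g)
    (hgs : tsupport g ⊆ Ioo α β) (hg : Continuous g) :
    ∃ α' β', α < α' ∧ α' ≤ β' ∧ β' < β ∧ (∀ x ≤ α', g x = 0) ∧ (∀ x, β' ≤ x → g x = 0) := by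
  set K : Set ℝ := tsupport g ∪ {(α + β) / 2} with hK
  have hKc : IsCompact K := hgc.union isCompact_singleton
  have hKne : K.Nonempty := ⟨(α + β) / 2, Or.inr rfl⟩
  have hKsub : K ⊆ Ioo α β := union_subset hgs (by
    rintro x (rfl : x = (α + β) / 2); constructor <;> linarith)
  obtain ⟨α', hα'K, hα'le⟩ := hKc.exists_isLeast hKne
  obtain ⟨β', hβ'K, hβ'ge⟩ := hKc.exists_isGreatest hKne
  refine ⟨α', β', (hKsub hα'K).1, hα'le hβ'K, (hKsub hβ'K).2, ?_, ?_⟩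
  · intro x hx
    by_contra hne
    -- `x ∈ support g`, open, so contains points `< α'` of the support unless `x < α'` already
    rcases lt_or_eq_of_le hx with hlt | rfl
    · exact hne (image_eq_zero_of_notMem_tsupport fun hxK ↦ absurd (hα'le (Or.inl hxK)) (not_le.2 hlt))
    · have hopen : IsOpen (Function.support g) := hg.isOpen_support
      obtain ⟨ε, hε, hball⟩ := Metric.isOpen_iff.mp hopen x hne
      have hmem : x - ε / 2 ∈ Function.support g := hball (by
        rw [Metric.mem_ball, Real.dist_eq, show x - ε / 2 - x = -(ε / 2) by ring, abs_neg,
          abs_of_pos (by linarith)]; linarith)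
      have := hα'le (Or.inl (subset_tsupport _ hmem))
      linarith
  · intro x hx
    by_contra hne
    rcases lt_or_eq_of_le hx with hlt | rfl
    · exact hne (image_eq_zero_of_notMem_tsupport fun hxK ↦ absurd (hβ'ge (Or.inl hxK)) (not_le.2 hlt))
    · have hopen : IsOpen (Function.support g) := hg.isOpen_support
      obtain ⟨ε, hε, hball⟩ := Metric.isOpen_iff.mp hopen β' hne
      have hmem : β' + ε / 2 ∈ Function.support g := hball (by
        rw [Metric.mem_ball, Real.dist_eq, show β' + ε / 2 - β' = ε / 2 by ring,
          abs_of_pos (by linarith)]; linarith)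
      have := hβ'ge (Or.inl (subset_tsupport _ hmem))
      linarith

/-- The primitive of a test function with integral zero is a test function. [folklore] -/
private theorem primitive_test {g : ℝ → ℝ} (hαβ : α < β) (hg : ContDiff ℝ ∞ g)
    (hgc : HasCompactSupport g) (hgs : tsupport g ⊆ Ioo α β) (hint : ∫ x, g x = 0) :
    ContDiff ℝ ∞ (fun x ↦ ∫ t in α..x, g t) ∧ HasCompactSupport (fun x ↦ ∫ t in α..x, g t) ∧
      tsupport (fun x ↦ ∫ t in α..x, g t) ⊆ Ioo α β ∧
      ∀ x, deriv (fun x ↦ ∫ t in α..x, g t) x = g x := by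
  have hgcont : Continuous g := hg.continuous
  have hderiv : ∀ x, deriv (fun x ↦ ∫ t in α..x, g t) x = g x :=
    fun x ↦ hgcont.deriv_integral g α x
  have hdiff : Differentiable ℝ (fun x ↦ ∫ t in α..x, g t) :=
    fun x ↦ (hgcont.integral_hasStrictDerivAt α x).hasDerivAt.differentiableAt
  have hsmooth : ContDiff ℝ ∞ (fun x ↦ ∫ t in α..x, g t) := by
    rw [contDiff_infty_iff_deriv]
    refine ⟨hdiff, ?_⟩
    rw [show deriv (fun x ↦ ∫ t in α..x, g t) = g from funext hderiv]
    exact hg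
  obtain ⟨α', β', hα', hα'β', hβ', hlo, hhi⟩ := exists_Icc_of_tsupport_subset hαβ hgc hgs hgcont
  -- the primitive vanishes left of `α'` and right of `β'`
  have hsupp_g : Function.support g ⊆ Ioo α' β' := by
    intro x hx
    rw [Function.mem_support] at hx
    constructor
    · by_contra h; exact hx (hlo x (not_lt.mp h))
    · by_contra h; exact hx (hhi x (not_lt.mp h))
  have hzero : ∀ x, x ∉ Ioo α' β' → (∫ t in α..x, g t) = 0 := by
    intro x hx
    rw [mem_Ioo, not_and_or, not_lt, not_lt] at hx
    rcases hx with hx | hx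
    · -- `x ≤ α'`: `g` vanishes on `[min α x, max α x] ⊆ (-∞, α']`
      rw [intervalIntegral.integral_congr (g := fun _ ↦ (0 : ℝ)) ?_, intervalIntegral.integral_zero]
      intro t ht
      have : t ≤ α' := by
        rcases mem_uIcc.mp ht with ⟨_, h2⟩ | ⟨_, h2⟩
        · exact h2.trans hx
        · exact h2.trans hα'.le
      exact hlo t this
    · -- `β' ≤ x`: the interval contains the support, so the integral is the total integral `0`
      rw [intervalIntegral.integral_eq_integral_of_support_subset, hint]
      exact hsupp_g.trans (Ioo_subset_Ioc_self.trans (Ioc_subset_Ioc hα'.le hx))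
  have hsupp : Function.support (fun x ↦ ∫ t in α..x, g t) ⊆ Ioo α' β' := by
    intro x hx
    by_contra h
    exact hx (hzero x h)
  have htsupp : tsupport (fun x ↦ ∫ t in α..x, g t) ⊆ Icc α' β' :=
    closure_minimal (hsupp.trans Ioo_subset_Icc_self) isClosed_Icc
  refine ⟨hsmooth, ?_, htsupp.trans (Icc_subset_Ioo hα' hβ'), hderiv⟩
  exact HasCompactSupport.of_support_subset_isCompact isCompact_Icc (hsupp.trans Ioo_subset_Icc_self)

/-- A continuous compactly supported `g` with `tsupport g ⊆ U` times a function locally integrable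
on `U` is integrable. [folklore] -/
private theorem integrable_mul_of_tsupport_subset {U : Set ℝ} {v : ℝ → ℂ}
    (hv : LocallyIntegrableOn v U) {g : ℝ → ℝ} (hg : Continuous g) (hgc : HasCompactSupport g)
    (hgs : tsupport g ⊆ U) : Integrable (fun x ↦ (g x : ℂ) * v x) := by
  have heq : (tsupport g).indicator (fun x ↦ (g x : ℂ) * v x) = fun x ↦ (g x : ℂ) * v x := by
    apply indicator_eq_self.2
    apply Function.support_subset_iff'.2
    intro x hx
    simp [image_eq_zero_of_notMem_tsupport hx]
  rw [← heq, integrable_indicator_iff (isClosed_tsupport g).measurableSet]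
  have h1 : IntegrableOn v (tsupport g) := hv.integrableOn_compact_subset hgs hgc
  have h2 : MemLp (fun x ↦ (g x : ℂ)) ∞ (volume.restrict (tsupport g)) :=
    (Complex.continuous_ofReal.comp hg).memLp_top_of_hasCompactSupport
      (hgc.comp_left Complex.ofReal_zero) _
  exact (h1.integrable.smul_of_top_right h2).congr (Eventually.of_forall fun x ↦ rfl)

/-- **du Bois-Reymond lemma** (order one, weak form on an open interval): if a locally integrable
`v` on `(α, β)` satisfies `∫ Θ′ v = 0` for every test function `Θ` supported in `(α, β)`, then `v`
is a.e. constant on `(α, β)`. [folklore] -/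
private theorem ae_eq_const_of_integral_deriv_mul_eq_zero (hαβ : α < β) {v : ℝ → ℂ}
    (hv : LocallyIntegrableOn v (Ioo α β))
    (h : ∀ Θ : ℝ → ℝ, ContDiff ℝ ∞ Θ → HasCompactSupport Θ → tsupport Θ ⊆ Ioo α β →
      ∫ x, ((deriv Θ x : ℝ) : ℂ) * v x = 0) :
    ∃ k : ℂ, ∀ᵐ x, x ∈ Ioo α β → v x = k := by
  obtain ⟨φ₂, hφ₂, hφ₂c, hφ₂s, hφ₂i⟩ := exists_smooth_bump hαβ
  refine ⟨∫ x, (φ₂ x : ℂ) * v x, ?_⟩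
  set k : ℂ := ∫ x, (φ₂ x : ℂ) * v x with hk
  have hvk : LocallyIntegrableOn (fun x ↦ v x - k) (Ioo α β) :=
    hv.sub (locallyIntegrableOn_const _)
  have key := isOpen_Ioo.ae_eq_zero_of_integral_contDiff_smul_eq_zero (μ := volume) hvk ?_
  · filter_upwards [key] with x hx hxU
    exact sub_eq_zero.mp (hx hxU)
  intro g hg hgc hgs
  -- `g₀ := g − (∫ g) φ₂` has integral zero; its primitive is a test function
  set c : ℝ := ∫ x, g x with hc
  set g₀ : ℝ → ℝ := fun x ↦ g x - c * φ₂ x with hg₀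
  have hg₀s : ContDiff ℝ ∞ g₀ := hg.sub (contDiff_const.mul hφ₂)
  have hg₀c : HasCompactSupport g₀ := hgc.sub (hφ₂c.mul_left)
  have hg₀supp : tsupport g₀ ⊆ Ioo α β :=
    (tsupport_sub g _).trans (union_subset hgs ((tsupport_mul_subset_right).trans hφ₂s))
  have hgi : Integrable g := hg.continuous.integrable_of_hasCompactSupport hgc
  have hφ₂int : Integrable φ₂ := hφ₂.continuous.integrable_of_hasCompactSupport hφ₂c
  have hg₀i : ∫ x, g₀ x = 0 := by
    simp only [hg₀]
    rw [integral_sub hgi (hφ₂int.const_mul c), integral_const_mul, hφ₂i, mul_one, sub_self]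
  obtain ⟨hΘs, hΘc, hΘsupp, hΘd⟩ := primitive_test hαβ hg₀s hg₀c hg₀supp hg₀i
  have h0 := h _ hΘs hΘc hΘsupp
  simp_rw [hΘd] at h0
  simp only [hg₀] at h0
  -- `∫ g₀ v = ∫ g v − c k = 0`
  have hgv : Integrable (fun x ↦ (g x : ℂ) * v x) :=
    integrable_mul_of_tsupport_subset hv hg.continuous hgc hgs
  have hφv : Integrable (fun x ↦ (φ₂ x : ℂ) * v x) :=
    integrable_mul_of_tsupport_subset hv hφ₂.continuous hφ₂c hφ₂s
  have h1 : ∫ x, (g x : ℂ) * v x = c * k := by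
    have : (fun x ↦ ((g x - c * φ₂ x : ℝ) : ℂ) * v x) =
        fun x ↦ (g x : ℂ) * v x - (c : ℂ) * ((φ₂ x : ℂ) * v x) := by
      funext x; push_cast; ring
    rw [this, integral_sub hgv (hφv.const_mul _), integral_const_mul] at h0
    exact sub_eq_zero.mp h0
  -- conclude `∫ g • (v − k) = 0`
  have h2 : ∫ x, (g x : ℂ) * k = c * k := by
    rw [integral_mul_const, integral_complex_ofReal, ← hc]
  calc ∫ x, g x • (v x - k) = ∫ x, ((g x : ℂ) * v x - (g x : ℂ) * k) := by
        congr 1; funext x; rw [Complex.real_smul, mul_sub]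
    _ = (∫ x, (g x : ℂ) * v x) - ∫ x, (g x : ℂ) * k := integral_sub hgv (hgi.ofReal.mul_const k)
    _ = 0 := by rw [h1, h2, sub_self]

/-- Frame of a test function: `supp Θ, supp Θ′ ⊆ (a, b)` with `α < a < b < β`. [folklore] -/
private theorem exists_frame {Θ : ℝ → ℝ} (hαβ : α < β) (hΘ : ContDiff ℝ ∞ Θ)
    (hΘc : HasCompactSupport Θ) (hΘs : tsupport Θ ⊆ Ioo α β) :
    ∃ a b, α < a ∧ a < b ∧ b < β ∧ Function.support Θ ⊆ Ioo a b ∧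
      Function.support (deriv Θ) ⊆ Ioo a b := by
  obtain ⟨α', β', hα', hα'β', hβ', hlo, hhi⟩ :=
    exists_Icc_of_tsupport_subset hαβ hΘc hΘs hΘ.continuous
  have hsupp : Function.support Θ ⊆ Ioo α' β' := by
    intro x hx
    rw [Function.mem_support] at hx
    constructor
    · by_contra h; exact hx (hlo x (not_lt.mp h))
    · by_contra h; exact hx (hhi x (not_lt.mp h))
  have htsupp : tsupport Θ ⊆ Icc α' β' :=
    closure_minimal (hsupp.trans Ioo_subset_Icc_self) isClosed_Icc
  exact ⟨(α + α') / 2, (β' + β) / 2, by linarith, by linarith, by linarith,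
    hsupp.trans (Ioo_subset_Ioo (by linarith) (by linarith)),
    (support_deriv_subset.trans htsupp).trans (Icc_subset_Ioo (by linarith) (by linarith))⟩

/-- **du Bois-Reymond with a continuous right-hand side**: if `∫ Θ′ v = −∫ Θ w` for every test
function `Θ` on `(α, β)` with `w` continuous there, then `v` agrees a.e. on `(α, β)` with a
primitive of `w` plus a constant. [folklore] -/
private theorem ae_eq_primitive_add_const (hαβ : α < β) {v w : ℝ → ℂ}
    (hv : LocallyIntegrableOn v (Ioo α β)) (hw : ContinuousOn w (Ioo α β)) {x₁ : ℝ}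
    (hx₁ : x₁ ∈ Ioo α β)
    (h : ∀ Θ : ℝ → ℝ, ContDiff ℝ ∞ Θ → HasCompactSupport Θ → tsupport Θ ⊆ Ioo α β →
      ∫ x, ((deriv Θ x : ℝ) : ℂ) * v x = -∫ x, (Θ x : ℂ) * w x) :
    ∃ k : ℂ, ∀ᵐ x, x ∈ Ioo α β → v x = (∫ t in x₁..x, w t) + k := by
  set G : ℝ → ℂ := fun x ↦ ∫ t in x₁..x, w t with hG
  have hGd : ∀ x ∈ Ioo α β, HasDerivAt G (w x) x := by
    intro x hx
    have hsub : uIcc x₁ x ⊆ Ioo α β := fun y hy ↦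
      ⟨lt_of_lt_of_le (lt_min hx₁.1 hx.1) hy.1, lt_of_le_of_lt hy.2 (max_lt hx₁.2 hx.2)⟩
    exact intervalIntegral.integral_hasDerivAt_right ((hw.mono hsub).intervalIntegrable)
      (hw.stronglyMeasurableAtFilter isOpen_Ioo x hx) (hw.continuousAt (isOpen_Ioo.mem_nhds hx))
  have hGc : ContinuousOn G (Ioo α β) := fun x hx ↦ (hGd x hx).continuousAt.continuousWithinAt
  have hGli : LocallyIntegrableOn G (Ioo α β) := hGc.locallyIntegrableOn measurableSet_Ioo
  have hvG : LocallyIntegrableOn (fun x ↦ v x - G x) (Ioo α β) := hv.sub hGli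
  suffices hyp : ∀ Θ : ℝ → ℝ, ContDiff ℝ ∞ Θ → HasCompactSupport Θ → tsupport Θ ⊆ Ioo α β →
      ∫ x, ((deriv Θ x : ℝ) : ℂ) * (v x - G x) = 0 by
    obtain ⟨k, hk⟩ := ae_eq_const_of_integral_deriv_mul_eq_zero hαβ hvG hyp
    exact ⟨k, by filter_upwards [hk] with x hx hxU; rw [sub_eq_iff_eq_add.mp (hx hxU), add_comm]⟩
  intro Θ hΘ hΘc hΘs
  obtain ⟨a, b, ha, hab, hb, hsΘ, hsΘ'⟩ := exists_frame hαβ hΘ hΘc hΘs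
  have hIcc : Icc a b ⊆ Ioo α β := Icc_subset_Ioo ha hb
  have hΘd : ∀ x, HasDerivAt (fun y ↦ (Θ y : ℂ)) ((deriv Θ x : ℝ) : ℂ) x := fun x ↦
    ((hΘ.differentiable (by simp)).differentiableAt.hasDerivAt).ofReal_comp
  have hΘ'cont : Continuous fun x ↦ ((deriv Θ x : ℝ) : ℂ) :=
    Complex.continuous_ofReal.comp (hΘ.continuous_deriv (by simp))
  -- integration by parts on `[a, b]`
  have hparts := intervalIntegral.integral_deriv_mul_eq_sub (a := a) (b := b)
    (u := fun y ↦ (Θ y : ℂ)) (v := G) (u' := fun x ↦ ((deriv Θ x : ℝ) : ℂ)) (v' := w)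
    (fun x _ ↦ hΘd x) (fun x hx ↦ hGd x (hIcc (by rwa [uIcc_of_le hab.le] at hx)))
    (hΘ'cont.intervalIntegrable a b)
    ((hw.mono ((uIcc_of_le hab.le).symm ▸ hIcc)).intervalIntegrable)
  have hΘa : (Θ a : ℂ) = 0 := by
    rw [show Θ a = 0 from by
      by_contra hne; exact (lt_irrefl a) (hsΘ (Function.mem_support.mpr hne)).1]; simp
  have hΘb : (Θ b : ℂ) = 0 := by
    rw [show Θ b = 0 from by
      by_contra hne; exact (lt_irrefl b) (hsΘ (Function.mem_support.mpr hne)).2]; simp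
  rw [hΘa, hΘb, zero_mul, zero_mul, sub_zero] at hparts
  -- the two summands are separately integrable on `[a, b]`
  have hi1 : IntervalIntegrable (fun x ↦ ((deriv Θ x : ℝ) : ℂ) * G x) volume a b :=
    (hΘ'cont.continuousOn.mul (hGc.mono ((uIcc_of_le hab.le).symm ▸ hIcc))).intervalIntegrable
  have hi2 : IntervalIntegrable (fun x ↦ (Θ x : ℂ) * w x) volume a b :=
    ((Complex.continuous_ofReal.comp hΘ.continuous).continuousOn.mul
      (hw.mono ((uIcc_of_le hab.le).symm ▸ hIcc))).intervalIntegrable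
  rw [intervalIntegral.integral_add hi1 hi2] at hparts
  -- whole-line integrals are integrals over `[a, b]`
  have hsupp1 : Function.support (fun x ↦ ((deriv Θ x : ℝ) : ℂ) * G x) ⊆ Ioc a b := by
    intro x hx
    rw [Function.mem_support] at hx
    have : deriv Θ x ≠ 0 := fun h0 ↦ hx (by rw [h0]; simp)
    exact Ioo_subset_Ioc_self (hsΘ' (Function.mem_support.mpr this))
  have hsupp2 : Function.support (fun x ↦ (Θ x : ℂ) * w x) ⊆ Ioc a b := by
    intro x hx
    rw [Function.mem_support] at hx
    have : Θ x ≠ 0 := fun h0 ↦ hx (by rw [h0]; simp)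
    exact Ioo_subset_Ioc_self (hsΘ (Function.mem_support.mpr this))
  have e1 : ∫ x, ((deriv Θ x : ℝ) : ℂ) * G x = ∫ x in a..b, ((deriv Θ x : ℝ) : ℂ) * G x :=
    (intervalIntegral.integral_eq_integral_of_support_subset hsupp1).symm
  have e2 : ∫ x, (Θ x : ℂ) * w x = ∫ x in a..b, (Θ x : ℂ) * w x :=
    (intervalIntegral.integral_eq_integral_of_support_subset hsupp2).symm
  -- assemble
  have hI1 : Integrable (fun x ↦ ((deriv Θ x : ℝ) : ℂ) * v x) :=
    integrable_mul_of_tsupport_subset hv (hΘ.continuous_deriv (by simp)) hΘc.deriv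
      (tsupport_deriv_subset.trans hΘs)
  have hI2 : Integrable (fun x ↦ ((deriv Θ x : ℝ) : ℂ) * G x) :=
    integrable_mul_of_tsupport_subset hGli (hΘ.continuous_deriv (by simp)) hΘc.deriv
      (tsupport_deriv_subset.trans hΘs)
  calc ∫ x, ((deriv Θ x : ℝ) : ℂ) * (v x - G x)
      = (∫ x, ((deriv Θ x : ℝ) : ℂ) * v x) - ∫ x, ((deriv Θ x : ℝ) : ℂ) * G x := by
        rw [← integral_sub hI1 hI2]; congr 1; funext x; ring
    _ = 0 := by rw [h Θ hΘ hΘc hΘs, e1, e2]; linear_combination -hparts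


/-- **Integration by parts against a primitive of an `L¹` function** (Fubini on the triangle):
for `h ∈ L¹(α, β)` and a test function `Θ` on `(α, β)`,
`∫ Θ′(x) (∫_α^x h) dx = −∫ Θ h`. [folklore] -/
private theorem integral_deriv_mul_primitive (hαβ : α < β) {h : ℝ → ℂ}
    (hh : IntegrableOn h (Ioo α β)) {Θ : ℝ → ℝ} (hΘ : ContDiff ℝ ∞ Θ)
    (hΘc : HasCompactSupport Θ) (hΘs : tsupport Θ ⊆ Ioo α β) :
    ∫ x, ((deriv Θ x : ℝ) : ℂ) * (∫ t in α..x, h t) = -∫ x, (Θ x : ℂ) * h x := by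
  obtain ⟨a, b, ha, hab, hb, hsΘ, hsΘ'⟩ := exists_frame hαβ hΘ hΘc hΘs
  set D : ℝ → ℂ := fun x ↦ ((deriv Θ x : ℝ) : ℂ) with hD
  have hDcont : Continuous D := Complex.continuous_ofReal.comp (hΘ.continuous_deriv (by simp))
  have hD0 : ∀ x, x ∉ Ioo a b → D x = 0 := fun x hx ↦ by
    have : deriv Θ x = 0 := by
      by_contra hne; exact hx (hsΘ' (Function.mem_support.mpr hne))
    simp [hD, this]
  have hΘ0 : ∀ x, x ∉ Ioo a b → (Θ x : ℂ) = 0 := fun x hx ↦ by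
    have : Θ x = 0 := by
      by_contra hne; exact hx (hsΘ (Function.mem_support.mpr hne))
    simp [this]
  have hΘd : ∀ x, HasDerivAt (fun y ↦ (Θ y : ℂ)) (D x) x := fun x ↦
    ((hΘ.differentiable (by simp)).differentiableAt.hasDerivAt).ofReal_comp
  -- the box `S = (α, b]`, the kernel `K x t = 1_{t ≤ x} Θ′(x) h(t)`
  set S : Set ℝ := Ioc α b with hS
  have hSsub : S ⊆ Ioo α β := fun x hx ↦ ⟨hx.1, lt_of_le_of_lt hx.2 hb⟩
  have hhS : Integrable h (volume.restrict S) := hh.mono_set hSsub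
  have hDS : Integrable D (volume.restrict S) :=
    (hDcont.integrable_of_hasCompactSupport (hΘc.deriv.comp_left Complex.ofReal_zero)).restrict
  set K : ℝ → ℝ → ℂ := fun x t ↦ if t ≤ x then D x * h t else 0 with hK
  have hKint : Integrable (Function.uncurry K) ((volume.restrict S).prod (volume.restrict S)) := by
    have := (hDS.mul_prod hhS).indicator
      (measurableSet_le measurable_snd measurable_fst : MeasurableSet {p : ℝ × ℝ | p.2 ≤ p.1})
    refine this.congr (Eventually.of_forall fun p ↦ ?_)
    simp only [Function.uncurry, hK, indicator, mem_setOf_eq]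
  have hswap := integral_integral_swap hKint
  -- order 1: `∫_x ∫_t K = ∫ Θ′ F`
  have h1 : ∀ x ∈ S, ∫ t in S, K x t = D x * ∫ t in α..x, h t := by
    intro x hx
    have e : (fun t ↦ K x t) = fun t ↦ D x * (Iic x).indicator h t := by
      funext t; simp only [hK, indicator, mem_Iic]; split_ifs <;> simp
    rw [e, integral_const_mul, setIntegral_indicator measurableSet_Iic,
      intervalIntegral.integral_of_le hx.1.le]
    congr 2
    rw [hS, Ioc_inter_Iic, min_eq_right hx.2]
  have hL : ∫ x in S, ∫ t in S, K x t = ∫ x, D x * ∫ t in α..x, h t := by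
    rw [setIntegral_congr_fun measurableSet_Ioc h1]
    refine setIntegral_eq_integral_of_forall_compl_eq_zero fun x hx ↦ ?_
    rw [hD0 x (fun hx' ↦ hx ⟨lt_trans ha hx'.1, hx'.2.le⟩), zero_mul]
  -- order 2: `∫_t ∫_x K = -∫ Θ h`
  have h2 : ∀ t ∈ S, ∫ x in S, K x t = -(Θ t : ℂ) * h t := by
    intro t ht
    have e : (fun x ↦ K x t) = fun x ↦ (Ici t).indicator D x * h t := by
      funext x; simp only [hK, indicator, mem_Ici]; split_ifs <;> simp
    rw [e, integral_mul_const, setIntegral_indicator measurableSet_Ici]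
    have hset : S ∩ Ici t = Icc t b := by
      ext x; simp only [hS, mem_inter_iff, mem_Ioc, mem_Ici, mem_Icc]
      constructor
      · rintro ⟨⟨_, h2⟩, h3⟩; exact ⟨h3, h2⟩
      · rintro ⟨h1, h2⟩; exact ⟨⟨lt_of_lt_of_le ht.1 h1, h2⟩, h1⟩
    rw [hset, integral_Icc_eq_integral_Ioc, ← intervalIntegral.integral_of_le ht.2,
      intervalIntegral.integral_eq_sub_of_hasDerivAt (fun x _ ↦ hΘd x)
        (hDcont.intervalIntegrable _ _),
      hΘ0 b (fun h' ↦ (lt_irrefl b) h'.2)]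
    ring
  have hR : ∫ t in S, ∫ x in S, K x t = -∫ t, (Θ t : ℂ) * h t := by
    rw [setIntegral_congr_fun measurableSet_Ioc h2, ← integral_neg]
    refine (setIntegral_eq_integral_of_forall_compl_eq_zero fun t ht ↦ ?_).trans ?_
    · rw [hΘ0 t (fun ht' ↦ ht ⟨lt_trans ha ht'.1, ht'.2.le⟩), neg_zero, zero_mul]
    · congr 1; funext t; ring
  rw [← hL, hswap, hR]


end TestFunctions

/-! ## §2a. Private toolkit (continued): the weak identities, Fubini against a bump, the side-interval
first-order equation — copied from `UVProlateBoundaryFunctional.lean` (§2–§4 there, where the last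
three are public; private copies here because that module's olean was unavailable on the farm when
this file was written — replace by the import once it is rebuilt) -/

section WeakIdentities

variable (lam : ℝ)

/-- A Schwartz function times an `L²` function is integrable. [folklore] -/
private theorem integrable_schwartz_mul_Lp (θ : 𝓢(ℝ, ℂ)) (u : L2R) :
    Integrable (fun x ↦ θ x * u x) :=
  (θ.memLp 2 volume).integrable_mul (Lp.memLp u)

/-- `W θ = −(p θ′)′ + q θ` pointwise, in `pCoeff`/`qCoeff` notation. [cite: ConnesMoscovici2022, §1 eq. (1.1) (= arXiv (2.1), chunk p0004:L5–L9)] -/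
private theorem prolateSchwartz_apply_pq (θ : 𝓢(ℝ, ℂ)) (x : ℝ) :
    prolateSchwartz lam θ x =
      -deriv (fun y ↦ pCoeff lam y * deriv θ y) x + qCoeff lam x * θ x := by
  rw [prolateSchwartz_apply, prolateWaveOpFun]
  have e : (fun y ↦ ((lam ^ 2 - y ^ 2 : ℝ) : ℂ) * deriv θ y) = fun y ↦ pCoeff lam y * deriv θ y := by
    funext y; rfl
  rw [e, qCoeff]
  push_cast
  ring

/-- `(p θ′)′` is (the underlying function of) a Schwartz map. [folklore] -/
private theorem deriv_pCoeff_mul_deriv_eq (θ : 𝓢(ℝ, ℂ)) (x : ℝ) :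
    deriv (fun y ↦ pCoeff lam y * deriv θ y) x =
      (derivCLM ℂ ℂ (smulLeftCLM ℂ (pCoeff lam) (derivCLM ℂ ℂ θ))) x := by
  have e : ⇑(smulLeftCLM ℂ (pCoeff lam) (derivCLM ℂ ℂ θ)) = fun y ↦ pCoeff lam y * deriv θ y := by
    funext y
    rw [smulLeftCLM_apply_apply (pCoeff_hasTemperateGrowth lam), derivCLM_apply, smul_eq_mul]
  rw [derivCLM_apply, e]

/-- RH-FREE (PROVED). **The adjoint identity, bilinear form**: for `ξ ∈ dom W_max` and Schwartz
`θ`, `∫ (Wθ)·ξ = ∫ θ·(W_max ξ)` — i.e. `W_max ξ` is the distribution `Wξ` ("with `Wξ` viewed as a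
tempered distribution", eq. (1.2)); obtained from Mathlib's `⟪W_max ξ, θ̄⟫ = ⟪ξ, W θ̄⟫` and the
reality of `W`. [cite: ConnesMoscovici2022, §1 eq. (1.2) and proof of Lemma 1.2 (= arXiv (2.2), chunk p0004:L16–L22, L58–L62)] -/
private theorem integral_prolateSchwartz_mul_eq_c (ξ : (prolateMax lam).domain) (θ : 𝓢(ℝ, ℂ)) :
    ∫ x, prolateSchwartz lam θ x * (ξ : L2R) x = ∫ x, θ x * (prolateMax lam ξ : L2R) x := by
  set θc : 𝓢(ℝ, ℂ) := SchwartzMap.postcompCLM (Complex.conjCLE : ℂ →L[ℝ] ℂ) θ with hθc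
  have hθc_apply : ∀ x, θc x = star (θ x) := fun x ↦ rfl
  have hadj := LinearPMap.adjoint_isFormalAdjoint (T := prolateCore lam) dense_schwartzL2 ξ
    ⟨schwartzToL2 θc, LinearMap.mem_range_self _ θc⟩
  rw [prolateCore_apply] at hadj
  -- `⟪W_max ξ, θ̄⟫ = ⟪ξ, W θ̄⟫` as integrals
  change ⟪(prolateMax lam ξ : L2R), (θc.toLp 2 volume : L2R)⟫_ℂ =
    ⟪((ξ : L2R)), ((prolateSchwartz lam θc).toLp 2 volume : L2R)⟫_ℂ at hadj
  rw [L2.inner_def, L2.inner_def] at hadj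
  have h1 : ∫ x, ⟪(prolateMax lam ξ : L2R) x, (θc.toLp 2 volume : L2R) x⟫_ℂ =
      ∫ x, star (θ x * (prolateMax lam ξ : L2R) x) := by
    refine integral_congr_ae ?_
    filter_upwards [θc.coeFn_toLp 2 volume] with x hx
    rw [hx, hθc_apply]
    simp [mul_comm]
  have h2 : ∫ x, ⟪((ξ : L2R)) x, ((prolateSchwartz lam θc).toLp 2 volume : L2R) x⟫_ℂ =
      ∫ x, star (prolateSchwartz lam θ x * (ξ : L2R) x) := by
    refine integral_congr_ae ?_
    filter_upwards [(prolateSchwartz lam θc).coeFn_toLp 2 volume] with x hx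
    rw [hx, prolateSchwartz_apply, show (⇑θc : ℝ → ℂ) = fun y ↦ star (θ y) from funext hθc_apply,
      prolateWaveOpFun_star, ← prolateSchwartz_apply]
    simp [mul_comm]
  rw [h1, h2] at hadj
  simp only [Complex.star_def] at hadj
  rw [integral_conj, integral_conj] at hadj
  have := congrArg (starRingEnd ℂ) hadj
  simpa using this.symm

/-- RH-FREE (PROVED). **The weak equation** `(p ξ′)′ = q ξ − W_max ξ`: for `ξ ∈ dom W_max` and
Schwartz `θ`, `∫ ξ·(pθ′)′ = ∫ (qξ − W_max ξ)·θ` ("Let `η = W_max ξ`, one has by definition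
`⟨η | φ⟩ = ⟨ξ | W_min φ⟩ = ∫ ξ (∂(p∂φ) + qφ)`"). [cite: ConnesMoscovici2022, proof of Lemma 1.2 (= arXiv Lemma 2.2, chunk p0004:L58–L68)] -/
private theorem integral_mul_deriv_pCoeff_mul_deriv_c (ξ : (prolateMax lam).domain) (θ : 𝓢(ℝ, ℂ)) :
    ∫ x, (ξ : L2R) x * deriv (fun y ↦ pCoeff lam y * deriv θ y) x =
      ∫ x, (qCoeff lam x * (ξ : L2R) x - (prolateMax lam ξ : L2R) x) * θ x := by
  have h := integral_prolateSchwartz_mul_eq_c lam ξ θ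
  simp_rw [prolateSchwartz_apply_pq] at h
  have hi1 : Integrable (fun x ↦ deriv (fun y ↦ pCoeff lam y * deriv θ y) x * (ξ : L2R) x) := by
    simp_rw [deriv_pCoeff_mul_deriv_eq]
    exact integrable_schwartz_mul_Lp _ _
  have hi2 : Integrable (fun x ↦ qCoeff lam x * θ x * (ξ : L2R) x) := by
    have : (fun x ↦ qCoeff lam x * θ x * (ξ : L2R) x) =
        fun x ↦ (smulLeftCLM ℂ (qCoeff lam) θ) x * (ξ : L2R) x := by
      funext x; rw [smulLeftCLM_apply_apply (qCoeff_hasTemperateGrowth lam), smul_eq_mul]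
    rw [this]; exact integrable_schwartz_mul_Lp _ _
  have hi3 : Integrable (fun x ↦ θ x * (prolateMax lam ξ : L2R) x) := integrable_schwartz_mul_Lp _ _
  have e : (fun x ↦ (-deriv (fun y ↦ pCoeff lam y * deriv θ y) x + qCoeff lam x * θ x) * (ξ : L2R) x)
      = fun x ↦ -(deriv (fun y ↦ pCoeff lam y * deriv θ y) x * (ξ : L2R) x) +
          qCoeff lam x * θ x * (ξ : L2R) x := by
    funext x; ring
  have hi1' : Integrable (fun x ↦ -(deriv (fun y ↦ pCoeff lam y * deriv θ y) x * (ξ : L2R) x)) :=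
    hi1.neg
  rw [e, integral_add hi1' hi2, integral_neg] at h
  have e2 : (fun x ↦ (qCoeff lam x * (ξ : L2R) x - (prolateMax lam ξ : L2R) x) * θ x) =
      fun x ↦ qCoeff lam x * θ x * (ξ : L2R) x - θ x * (prolateMax lam ξ : L2R) x := by
    funext x; ring
  rw [e2, integral_sub hi2 hi3, ← h]
  have e3 : (fun x ↦ (ξ : L2R) x * deriv (fun y ↦ pCoeff lam y * deriv θ y) x) =
      fun x ↦ deriv (fun y ↦ pCoeff lam y * deriv θ y) x * (ξ : L2R) x := by
    funext x; ring
  rw [e3]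
  ring

end WeakIdentities

section BumpPrimitive

variable {α β : ℝ}

/-- **Fubini on the triangle, bump version**: for `h ∈ L¹(α, β)`, a test function `φ` on `(α, β)`
and `Ψ(t) = 1_{(α, β]}(t) ∫_t^β φ`, one has `∫ φ(x) (∫_α^x h) dx = ∫ Ψ h`.  (Integration by parts
against the primitive `F` of `h`, `F(α) = 0`, with the non-compactly-supported `Ψ`.) [folklore] -/
private theorem integral_bump_mul_primitive (hαβ : α < β) {h : ℝ → ℂ}
    (hh : IntegrableOn h (Ioo α β)) {φ : ℝ → ℝ} (hφ : ContDiff ℝ ∞ φ)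
    (hφc : HasCompactSupport φ) (hφs : tsupport φ ⊆ Ioo α β) :
    ∫ x, (φ x : ℂ) * (∫ t in α..x, h t) =
      ∫ t, (Ioc α β).indicator (fun t ↦ ((∫ x in t..β, φ x : ℝ) : ℂ)) t * h t := by
  obtain ⟨a, b, ha, hab, hb, hsφ, -⟩ := exists_frame hαβ hφ hφc hφs
  set D : ℝ → ℂ := fun x ↦ ((φ x : ℝ) : ℂ) with hD
  have hDcont : Continuous D := Complex.continuous_ofReal.comp hφ.continuous
  have hφ0 : ∀ x, x ∉ Ioo a b → φ x = 0 := fun x hx ↦ by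
    by_contra hne; exact hx (hsφ (Function.mem_support.mpr hne))
  have hD0 : ∀ x, x ∉ Ioo a b → D x = 0 := fun x hx ↦ by simp [hD, hφ0 x hx]
  -- the box `S = (α, b]`
  set S : Set ℝ := Ioc α b with hS
  have hSsub : S ⊆ Ioo α β := fun x hx ↦ ⟨hx.1, lt_of_le_of_lt hx.2 hb⟩
  have hhS : Integrable h (volume.restrict S) := hh.mono_set hSsub
  have hDS : Integrable D (volume.restrict S) :=
    (hDcont.integrable_of_hasCompactSupport (hφc.comp_left Complex.ofReal_zero)).restrict
  set K : ℝ → ℝ → ℂ := fun x t ↦ if t ≤ x then D x * h t else 0 with hK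
  have hKint : Integrable (Function.uncurry K) ((volume.restrict S).prod (volume.restrict S)) := by
    have := (hDS.mul_prod hhS).indicator
      (measurableSet_le measurable_snd measurable_fst : MeasurableSet {p : ℝ × ℝ | p.2 ≤ p.1})
    refine this.congr (Eventually.of_forall fun p ↦ ?_)
    simp only [Function.uncurry, hK, indicator, mem_setOf_eq]
  have hswap := integral_integral_swap hKint
  -- order 1
  have h1 : ∀ x ∈ S, ∫ t in S, K x t = D x * ∫ t in α..x, h t := by
    intro x hx
    have e : (fun t ↦ K x t) = fun t ↦ D x * (Iic x).indicator h t := by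
      funext t; simp only [hK, indicator, mem_Iic]; split_ifs <;> simp
    rw [e, integral_const_mul, setIntegral_indicator measurableSet_Iic,
      intervalIntegral.integral_of_le hx.1.le]
    congr 2
    rw [hS, Ioc_inter_Iic, min_eq_right hx.2]
  have hL : ∫ x in S, ∫ t in S, K x t = ∫ x, D x * ∫ t in α..x, h t := by
    rw [setIntegral_congr_fun measurableSet_Ioc h1]
    refine setIntegral_eq_integral_of_forall_compl_eq_zero fun x hx ↦ ?_
    rw [hD0 x (fun hx' ↦ hx ⟨lt_trans ha hx'.1, hx'.2.le⟩), zero_mul]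
  -- the tail integral `∫_t^β φ = ∫_t^b φ` for `t ∈ S`
  have htail : ∀ t ∈ S, (∫ x in t..β, φ x) = ∫ x in t..b, φ x := by
    intro t ht
    rw [← intervalIntegral.integral_add_adjacent_intervals (b := b)
      (hφ.continuous.intervalIntegrable _ _) (hφ.continuous.intervalIntegrable _ _)]
    have : (∫ x in b..β, φ x) = 0 := by
      rw [intervalIntegral.integral_congr (g := fun _ ↦ (0 : ℝ)) ?_, intervalIntegral.integral_zero]
      intro x hx
      rw [uIcc_of_le hb.le] at hx
      exact hφ0 x (fun hx' ↦ (lt_irrefl b) (lt_of_le_of_lt hx.1 hx'.2))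
    rw [this, add_zero]
  -- order 2
  have h2 : ∀ t ∈ S, ∫ x in S, K x t = ((∫ x in t..β, φ x : ℝ) : ℂ) * h t := by
    intro t ht
    have e : (fun x ↦ K x t) = fun x ↦ (Ici t).indicator D x * h t := by
      funext x; simp only [hK, indicator, mem_Ici]; split_ifs <;> simp
    rw [e, integral_mul_const, setIntegral_indicator measurableSet_Ici]
    have hset : S ∩ Ici t = Icc t b := by
      ext x; simp only [hS, mem_inter_iff, mem_Ioc, mem_Ici, mem_Icc]
      constructor
      · rintro ⟨⟨_, h2⟩, h3⟩; exact ⟨h3, h2⟩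
      · rintro ⟨h1, h2⟩; exact ⟨⟨lt_of_lt_of_le ht.1 h1, h2⟩, h1⟩
    rw [hset, integral_Icc_eq_integral_Ioc, ← intervalIntegral.integral_of_le ht.2, htail t ht,
      hD, intervalIntegral.integral_ofReal]
  have hR : ∫ t in S, ∫ x in S, K x t =
      ∫ t, (Ioc α β).indicator (fun t ↦ ((∫ x in t..β, φ x : ℝ) : ℂ)) t * h t := by
    rw [setIntegral_congr_fun measurableSet_Ioc h2]
    have H : ∀ t, t ∉ S →
        (Ioc α β).indicator (fun t ↦ ((∫ x in t..β, φ x : ℝ) : ℂ)) t * h t = 0 := by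
      intro t ht
      by_cases hta : t ∈ Ioc α β
      · rw [indicator_of_mem hta]
        have htb : b < t := by
          by_contra hle; exact ht ⟨hta.1, not_lt.mp hle⟩
        have : (∫ x in t..β, φ x) = 0 := by
          rw [intervalIntegral.integral_congr (g := fun _ ↦ (0 : ℝ)) ?_,
            intervalIntegral.integral_zero]
          intro x hx
          rw [uIcc_of_le hta.2] at hx
          exact hφ0 x (fun hx' ↦ (lt_irrefl b) (lt_trans htb (lt_of_le_of_lt hx.1 hx'.2)))
        rw [this]; simp
      · rw [indicator_of_notMem hta, zero_mul]
    rw [← setIntegral_eq_integral_of_forall_compl_eq_zero (s := S) H]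
    refine setIntegral_congr_fun measurableSet_Ioc fun t ht ↦ ?_
    rw [indicator_of_mem (show t ∈ Ioc α β from ⟨ht.1, (hSsub ht).2.le⟩)]
  rw [← hL, hswap, hR]

end BumpPrimitive

section SideInterval

variable {lam a b₀ : ℝ}

/-- A test function supported where `P ≠ 0`, divided by the smooth `P`, is smooth. [folklore] -/
private theorem contDiff_div_of_tsupport {Θ P : ℝ → ℝ} {U : Set ℝ} (hΘ : ContDiff ℝ ∞ Θ)
    (hP : ContDiff ℝ ∞ P) (hΘs : tsupport Θ ⊆ U) (hPU : ∀ x ∈ U, P x ≠ 0) :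
    ContDiff ℝ ∞ (fun x ↦ Θ x / P x) := by
  rw [contDiff_iff_contDiffAt]
  intro x
  by_cases hx : x ∈ tsupport Θ
  · exact hΘ.contDiffAt.div hP.contDiffAt (hPU x (hΘs hx))
  · have h0 : (fun y ↦ Θ y / P y) =ᶠ[𝓝 x] fun _ ↦ 0 := by
      filter_upwards [notMem_tsupport_iff_eventuallyEq.mp hx] with y hy
      rw [hy, Pi.zero_apply, zero_div]
    exact (contDiffAt_const (c := (0 : ℝ))).congr_of_eventuallyEq h0

/-- `h = q ξ − W_max ξ` is locally integrable. [folklore] -/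
private theorem locallyIntegrable_h (ξ : (prolateMax lam).domain) :
    LocallyIntegrable (fun t ↦ qCoeff lam t * (ξ : L2R) t - (prolateMax lam ξ : L2R) t) := by
  have hu : LocallyIntegrable (fun t ↦ ((ξ : L2R) : ℝ → ℂ) t) :=
    (Lp.memLp (ξ : L2R)).locallyIntegrable (by norm_num)
  have he : LocallyIntegrable (fun t ↦ ((prolateMax lam ξ : L2R) : ℝ → ℂ) t) :=
    (Lp.memLp (prolateMax lam ξ : L2R)).locallyIntegrable (by norm_num)
  have hq : Continuous (qCoeff lam) := by unfold qCoeff; fun_prop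
  have hqu : LocallyIntegrable (fun t ↦ qCoeff lam t * (ξ : L2R) t) := by
    rw [← locallyIntegrableOn_univ] at hu ⊢
    exact hu.continuousOn_mul hq.continuousOn isClosed_univ.isLocallyClosed
  exact hqu.sub he

/-- Interval integrability of `h`. [folklore] -/
private theorem intervalIntegrable_h (ξ : (prolateMax lam).domain) (x y : ℝ) :
    IntervalIntegrable (fun t ↦ qCoeff lam t * (ξ : L2R) t - (prolateMax lam ξ : L2R) t)
      volume x y :=
  (intervalIntegrable_iff').2 ((locallyIntegrable_h ξ).integrableOn_isCompact isCompact_uIcc)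

/-- `F(x) = ∫_a^x h` is continuous. [folklore] -/
private theorem continuous_F (ξ : (prolateMax lam).domain) (a : ℝ) :
    Continuous fun x ↦ ∫ t in a..x,
      (qCoeff lam t * (ξ : L2R) t - (prolateMax lam ξ : L2R) t) :=
  intervalIntegral.continuous_primitive (intervalIntegrable_h ξ) a

/-- RH-FREE (PROVED). **The weak first-order equation on the side interval** `J = (a, b₀)` (no zero of
`p` in `J`): with `h = qξ − W_max ξ`, `F(x) = ∫_a^x h`, a bump `φ₂` on `J` with `∫ φ₂ = 1` and the
constant `m = −∫ ξ (pφ₂)′ − ∫ φ₂ F`, every test function `Θ` on `J` satisfies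
`∫ Θ′ ξ = −∫ Θ (F + m)/p` — i.e. `p ξ′ = F + m` in `𝒟′(J)` ("It follows that
`⟨ψ − f₁ | ∂φ⟩ = 0` … `⟨ψ | φ⟩ = ⟨f₁ + s | φ⟩`").
[cite: ConnesMoscovici2022, proof of Lemma 1.2 (= arXiv Lemma 2.2, chunk p0004:L64–L84)] -/
private theorem integral_deriv_mul_eq_of_mem_prolateMax_c (hab : a < b₀)
    (hpJ : ∀ x ∈ Ioo a b₀, lam ^ 2 - x ^ 2 ≠ 0) (ξ : (prolateMax lam).domain)
    {φ₂ : ℝ → ℝ} (hφ₂ : ContDiff ℝ ∞ φ₂) (hφ₂c : HasCompactSupport φ₂)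
    (hφ₂s : tsupport φ₂ ⊆ Ioo a b₀) (hφ₂i : ∫ x, φ₂ x = 1)
    {Θ : ℝ → ℝ} (hΘ : ContDiff ℝ ∞ Θ) (hΘc : HasCompactSupport Θ) (hΘs : tsupport Θ ⊆ Ioo a b₀) :
    ∫ x, ((deriv Θ x : ℝ) : ℂ) * (ξ : L2R) x =
      -∫ x, (Θ x : ℂ) *
        (((∫ t in a..x, (qCoeff lam t * (ξ : L2R) t - (prolateMax lam ξ : L2R) t)) +
          (-(∫ y, (ξ : L2R) y * ((deriv (fun z ↦ (lam ^ 2 - z ^ 2) * φ₂ z) y : ℝ) : ℂ)) -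
            ∫ y, (φ₂ y : ℂ) *
              ∫ t in a..y, (qCoeff lam t * (ξ : L2R) t - (prolateMax lam ξ : L2R) t))) /
          ((lam ^ 2 - x ^ 2 : ℝ) : ℂ)) := by
  -- names
  set u : ℝ → ℂ := fun t ↦ ((ξ : L2R) : ℝ → ℂ) t with hu
  set h : ℝ → ℂ := fun t ↦ qCoeff lam t * (ξ : L2R) t - (prolateMax lam ξ : L2R) t with hh
  set F : ℝ → ℂ := fun x ↦ ∫ t in a..x, h t with hF
  set pR : ℝ → ℝ := fun x ↦ lam ^ 2 - x ^ 2 with hpR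
  have hpRs : ContDiff ℝ ∞ pR := by rw [hpR]; fun_prop
  have hpC : ∀ x, pCoeff lam x = ((pR x : ℝ) : ℂ) := fun x ↦ rfl
  set m : ℂ := -(∫ y, u y * ((deriv (fun z ↦ pR z * φ₂ z) y : ℝ) : ℂ)) -
    ∫ y, (φ₂ y : ℂ) * F y with hm
  -- the test function `Θ₀ = Θ − c·pφ₂` with `∫ Θ₀/p = 0`, and its `p`-primitive `θ`
  set c : ℝ := ∫ x, Θ x / pR x with hc
  set Θ₀ : ℝ → ℝ := fun x ↦ Θ x - c * (pR x * φ₂ x) with hΘ₀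
  have hΘ₀s : ContDiff ℝ ∞ Θ₀ := hΘ.sub (contDiff_const.mul (hpRs.mul hφ₂))
  have hΘ₀c : HasCompactSupport Θ₀ := hΘc.sub ((hφ₂c.mul_left).mul_left)
  have hΘ₀supp : tsupport Θ₀ ⊆ Ioo a b₀ :=
    (tsupport_sub _ _).trans (union_subset hΘs
      ((tsupport_mul_subset_right).trans ((tsupport_mul_subset_right).trans hφ₂s)))
  set ψ : ℝ → ℝ := fun x ↦ Θ₀ x / pR x with hψ
  have hψs : ContDiff ℝ ∞ ψ := contDiff_div_of_tsupport hΘ₀s hpRs hΘ₀supp hpJ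
  have hΘps : ContDiff ℝ ∞ (fun x ↦ Θ x / pR x) := contDiff_div_of_tsupport hΘ hpRs hΘs hpJ
  have hψ_eq : ∀ x, ψ x = Θ x / pR x - c * φ₂ x := by
    intro x
    simp only [hψ, hΘ₀]
    by_cases hx : pR x = 0
    · have hxJ : x ∉ Ioo a b₀ := fun hxJ ↦ hpJ x hxJ hx
      have : φ₂ x = 0 := image_eq_zero_of_notMem_tsupport fun h' ↦ hxJ (hφ₂s h')
      rw [this, hx]; simp
    · field_simp
  have hψc : HasCompactSupport ψ := hΘ₀c.mono fun x hx ↦ by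
    rw [Function.mem_support] at hx ⊢
    intro h0; exact hx (by simp [hψ, h0])
  have hψsupp : tsupport ψ ⊆ Ioo a b₀ := by
    refine (closure_mono fun x hx ↦ ?_).trans hΘ₀supp
    rw [Function.mem_support] at hx ⊢
    intro h0; exact hx (by simp [hψ, h0])
  -- vanishing outside `J`
  have hΘ0 : ∀ x, x ∉ Ioo a b₀ → Θ x = 0 := fun x hx ↦
    image_eq_zero_of_notMem_tsupport fun h' ↦ hx (hΘs h')
  have hφ0 : ∀ x, x ∉ Ioo a b₀ → φ₂ x = 0 := fun x hx ↦
    image_eq_zero_of_notMem_tsupport fun h' ↦ hx (hφ₂s h')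
  have hmul : ∀ y, pR y * ψ y = Θ₀ y := by
    intro y
    by_cases hy : pR y = 0
    · have hyJ : y ∉ Ioo a b₀ := fun hyJ ↦ hpJ y hyJ hy
      simp [hψ, hΘ₀, hy, hΘ0 y hyJ]
    · simp only [hψ]; field_simp
  -- integrals of `ψ`
  have hΘpc : HasCompactSupport (fun x ↦ Θ x / pR x) := hΘc.mono fun x hx ↦ by
    rw [Function.mem_support] at hx ⊢
    intro h0; exact hx (by simp [h0])
  have hΘpi : Integrable (fun x ↦ Θ x / pR x) :=
    hΘps.continuous.integrable_of_hasCompactSupport hΘpc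
  have hφ₂int : Integrable φ₂ := hφ₂.continuous.integrable_of_hasCompactSupport hφ₂c
  have hψi : ∫ x, ψ x = 0 := by
    rw [show ψ = fun x ↦ Θ x / pR x - c * φ₂ x from funext hψ_eq,
      integral_sub hΘpi (hφ₂int.const_mul c), integral_const_mul, hφ₂i, ← hc]
    ring
  obtain ⟨hθs, hθc, hθsupp, hθd⟩ := primitive_test hab hψs hψc hψsupp hψi
  -- the complex test function `θℂ` as a Schwartz map
  have hθcC : HasCompactSupport (fun x ↦ ((∫ t in a..x, ψ t : ℝ) : ℂ)) :=
    hθc.comp_left Complex.ofReal_zero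
  have hθsC : ContDiff ℝ ∞ (fun x ↦ ((∫ t in a..x, ψ t : ℝ) : ℂ)) :=
    (Complex.ofRealCLM.contDiff.of_le le_top).comp hθs
  set Φ : 𝓢(ℝ, ℂ) := hθcC.toSchwartzMap hθsC with hΦ
  have hΦ_apply : ∀ x, Φ x = ((∫ t in a..x, ψ t : ℝ) : ℂ) := fun x ↦ rfl
  have hΦd : ∀ y, deriv (⇑Φ) y = ((ψ y : ℝ) : ℂ) := by
    intro y
    have h1 : HasDerivAt (fun x ↦ ∫ t in a..x, ψ t) (ψ y) y := by
      have := (hθs.differentiable (by simp) y).hasDerivAt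
      rwa [hθd y] at this
    have h2 := h1.ofReal_comp
    exact h2.deriv
  have hpΦ : (fun y ↦ pCoeff lam y * deriv (⇑Φ) y) = fun y ↦ ((Θ₀ y : ℝ) : ℂ) := by
    funext y; rw [hpC, hΦd, ← Complex.ofReal_mul, hmul]
  -- derivatives of `Θ₀`
  have hpφd : ∀ x, HasDerivAt (fun z ↦ pR z * φ₂ z) (deriv (fun z ↦ pR z * φ₂ z) x) x := fun x ↦
    (((hpRs.mul hφ₂).differentiable (by simp)) x).hasDerivAt
  have hΘd' : ∀ x, HasDerivAt Θ (deriv Θ x) x := fun x ↦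
    ((hΘ.differentiable (by simp)) x).hasDerivAt
  have hΘ₀d : ∀ x, deriv Θ₀ x = deriv Θ x - c * deriv (fun z ↦ pR z * φ₂ z) x := fun x ↦
    ((hΘd' x).sub ((hpφd x).const_mul c)).deriv
  have hΘ₀dC : ∀ x, deriv (fun y ↦ ((Θ₀ y : ℝ) : ℂ)) x = ((deriv Θ₀ x : ℝ) : ℂ) := fun x ↦
    (((hΘ₀s.differentiable (by simp)) x).hasDerivAt.ofReal_comp).deriv
  -- (E1): the weak equation tested against `Φ`
  have E1 := integral_mul_deriv_pCoeff_mul_deriv_c lam ξ Φ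
  rw [hpΦ] at E1
  simp_rw [hΘ₀dC, hΘ₀d, hΦ_apply] at E1
  -- (E2): Fubini against the primitive
  have hhJ : IntegrableOn h (Ioo a b₀) :=
    (locallyIntegrable_h ξ).integrableOn_isCompact isCompact_Icc |>.mono_set Ioo_subset_Icc_self
  have E2 := integral_deriv_mul_primitive hab hhJ hθs hθc hθsupp
  simp_rw [hθd] at E2
  -- integrability of the pieces
  have hu_li : LocallyIntegrableOn u univ :=
    ((Lp.memLp (ξ : L2R)).locallyIntegrable (by norm_num)).locallyIntegrableOn _
  have hI_Θ'u : Integrable (fun x ↦ ((deriv Θ x : ℝ) : ℂ) * u x) :=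
    integrable_mul_of_tsupport_subset hu_li (hΘ.continuous_deriv (by simp)) hΘc.deriv (subset_univ _)
  have hI_pφ'u : Integrable (fun x ↦ ((deriv (fun z ↦ pR z * φ₂ z) x : ℝ) : ℂ) * u x) :=
    integrable_mul_of_tsupport_subset hu_li ((hpRs.mul hφ₂).continuous_deriv (by simp))
      (hφ₂c.mul_left).deriv (subset_univ _)
  have hFc : Continuous F := continuous_F ξ a
  have hF_li : LocallyIntegrableOn F univ := (hFc.locallyIntegrable).locallyIntegrableOn _
  have hI_ΘpF : Integrable (fun x ↦ ((Θ x / pR x : ℝ) : ℂ) * F x) :=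
    integrable_mul_of_tsupport_subset hF_li hΘps.continuous hΘpc (subset_univ _)
  have hI_φF : Integrable (fun x ↦ ((φ₂ x : ℝ) : ℂ) * F x) :=
    integrable_mul_of_tsupport_subset hF_li hφ₂.continuous hφ₂c (subset_univ _)
  have hI_Θp : Integrable (fun x ↦ ((Θ x / pR x : ℝ) : ℂ)) := hΘpi.ofReal
  -- rewrite (E1): `∫ u Θ' − c A = ∫ h θ`
  set A : ℂ := ∫ y, u y * ((deriv (fun z ↦ pR z * φ₂ z) y : ℝ) : ℂ) with hA
  set B : ℂ := ∫ y, (φ₂ y : ℂ) * F y with hB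
  have E1' : (∫ x, ((deriv Θ x : ℝ) : ℂ) * u x) - (c : ℂ) * A =
      ∫ x, h x * ((∫ t in a..x, ψ t : ℝ) : ℂ) := by
    rw [← E1]
    have e : (fun x ↦ u x * (((deriv Θ x - c * deriv (fun z ↦ pR z * φ₂ z) x : ℝ) : ℂ))) =
        fun x ↦ ((deriv Θ x : ℝ) : ℂ) * u x -
          (c : ℂ) * (((deriv (fun z ↦ pR z * φ₂ z) x : ℝ) : ℂ) * u x) := by
      funext x; push_cast; ring
    have hA' : ∫ y, ((deriv (fun z ↦ pR z * φ₂ z) y : ℝ) : ℂ) * u y = A := by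
      rw [hA]; congr 1; funext y; ring
    rw [show (fun x ↦ (ξ : L2R) x * (((deriv Θ x - c * deriv (fun z ↦ pR z * φ₂ z) x : ℝ) : ℂ)))
      = fun x ↦ u x * (((deriv Θ x - c * deriv (fun z ↦ pR z * φ₂ z) x : ℝ) : ℂ)) from rfl, e,
      integral_sub hI_Θ'u (hI_pφ'u.const_mul _), integral_const_mul, hA']
  -- rewrite (E2): `∫ ψ F = −∫ θ h`, and expand `ψ`
  have E2' : ∫ x, h x * ((∫ t in a..x, ψ t : ℝ) : ℂ) =
      -((∫ x, ((Θ x / pR x : ℝ) : ℂ) * F x) - (c : ℂ) * B) := by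
    have e : ∫ x, ((∫ t in a..x, ψ t : ℝ) : ℂ) * h x = ∫ x, h x * ((∫ t in a..x, ψ t : ℝ) : ℂ) := by
      congr 1; funext x; ring
    rw [← e, ← neg_eq_iff_eq_neg.mpr E2]  -- `∫ θ h = -∫ ψ F`
    congr 1
    have e2 : (fun x ↦ ((ψ x : ℝ) : ℂ) * F x) =
        fun x ↦ ((Θ x / pR x : ℝ) : ℂ) * F x - (c : ℂ) * (((φ₂ x : ℝ) : ℂ) * F x) := by
      funext x; rw [hψ_eq]; push_cast; ring
    rw [show (fun x ↦ ((ψ x : ℝ) : ℂ) * ∫ t in a..x, h t) = fun x ↦ ((ψ x : ℝ) : ℂ) * F x from rfl,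
      e2, integral_sub hI_ΘpF (hI_φF.const_mul _), integral_const_mul]
  -- the right-hand side of the goal
  have hc' : ∫ x, ((Θ x / pR x : ℝ) : ℂ) = (c : ℂ) := by
    rw [integral_complex_ofReal, ← hc]
  have epw : (fun x ↦ (Θ x : ℂ) * ((F x + m) / ((pR x : ℝ) : ℂ))) =
      fun x ↦ ((Θ x / pR x : ℝ) : ℂ) * F x + ((Θ x / pR x : ℝ) : ℂ) * m := by
    funext x
    by_cases hx : pR x = 0
    · have hxJ : x ∉ Ioo a b₀ := fun hxJ ↦ hpJ x hxJ hx
      simp [hΘ0 x hxJ]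
    · have hxC : ((pR x : ℝ) : ℂ) ≠ 0 := by exact_mod_cast hx
      push_cast
      field_simp
  have hR : ∫ x, (Θ x : ℂ) * ((F x + m) / ((pR x : ℝ) : ℂ)) =
      (∫ x, ((Θ x / pR x : ℝ) : ℂ) * F x) + (c : ℂ) * m := by
    rw [epw, integral_add hI_ΘpF (hI_Θp.mul_const m), integral_mul_const, hc']
  -- assemble
  show ∫ x, ((deriv Θ x : ℝ) : ℂ) * u x = -∫ x, (Θ x : ℂ) * ((F x + m) / ((pR x : ℝ) : ℂ))
  rw [hR]
  have := E1'.trans E2'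
  rw [hm]
  linear_combination this


end SideInterval

/-! ## §3. An eigenvector of `W_max` is a classical solution on every side interval -/

section EigenSideInterval

variable {lam : ℝ} {z : ℂ}

/-- For an eigenvector, `h = qξ − W_max ξ = (q − z)ξ` a.e. [cite: ConnesMoscovici2022, §1 eq. (1.2) (= arXiv (2.2), chunk p0004:L16–L22)] -/
theorem h_ae_eq_of_eigen (ξ : (prolateMax lam).domain) (hW : prolateMax lam ξ = z • (ξ : L2R)) :
    (fun t ↦ qCoeff lam t * (ξ : L2R) t - (prolateMax lam ξ : L2R) t) =ᵐ[volume]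
      fun t ↦ (qCoeff lam t - z) * (ξ : L2R) t := by
  have h1 : ((prolateMax lam ξ : L2R) : ℝ → ℂ) =ᵐ[volume] fun t ↦ z * (ξ : L2R) t := by
    rw [hW]
    filter_upwards [Lp.coeFn_smul z (ξ : L2R)] with t ht
    rw [ht, Pi.smul_apply, smul_eq_mul]
  filter_upwards [h1] with t ht
  rw [ht]; ring

/-- **Classical representative on a side interval.** Let `W_max ξ = z ξ` and let `(a, b₀)` contain
no zero of `p`.  Then `ξ` agrees a.e. on `(a, b₀)` with a classical solution pair `(g, g′)` of
`(p g′)′ = (q − z) g` ("a piecewise real analytic function … in the complement of the two regular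
singular points"; route: the weak first-order equation `p ξ′ = F + m` of the tree's proof of
Lemma 1.2, du Bois-Reymond, and the fundamental theorem of calculus for `F(x) = ∫_a^x (q − z)ξ`).
[cite: ConnesMoscovici2022, Lemma 1.1 proof (= arXiv Lemma 2.1, chunk p0004:L41–L44); Lemma 1.2 proof (= arXiv Lemma 2.2, chunk p0004:L64–L90)] -/
theorem exists_sol_ae_eq_of_eigen {a b₀ : ℝ} (hab : a < b₀)
    (hpJ : ∀ x ∈ Ioo a b₀, lam ^ 2 - x ^ 2 ≠ 0) (ξ : (prolateMax lam).domain)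
    (hW : prolateMax lam ξ = z • (ξ : L2R)) :
    ∃ g g' : ℝ → ℂ, (∀ x ∈ Ioo a b₀, HasDerivAt g (g' x) x) ∧
      (∀ x ∈ Ioo a b₀, HasDerivAt (fun y ↦ pCoeff lam y * g' y) ((qCoeff lam x - z) * g x) x) ∧
      ∀ᵐ x, x ∈ Ioo a b₀ → ((ξ : L2R) : ℝ → ℂ) x = g x := by
  obtain ⟨φ₂, hφ₂, hφ₂c, hφ₂s, hφ₂i⟩ := exists_smooth_bump hab
  set u : ℝ → ℂ := fun t ↦ ((ξ : L2R) : ℝ → ℂ) t with hu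
  set h : ℝ → ℂ := fun t ↦ qCoeff lam t * (ξ : L2R) t - (prolateMax lam ξ : L2R) t with hh
  set F : ℝ → ℂ := fun x ↦ ∫ t in a..x, h t with hF
  set m : ℂ := -(∫ y, (ξ : L2R) y * ((deriv (fun z ↦ (lam ^ 2 - z ^ 2) * φ₂ z) y : ℝ) : ℂ)) -
    ∫ y, (φ₂ y : ℂ) * F y with hm
  set w : ℝ → ℂ := fun x ↦ (F x + m) / pCoeff lam x with hw
  have hFc : Continuous F := continuous_F ξ a
  have hpc : Continuous (pCoeff lam) := continuous_pCoeff_def lam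
  have hp0 : ∀ x ∈ Ioo a b₀, pCoeff lam x ≠ 0 := fun x hx ↦ by
    unfold pCoeff; exact_mod_cast hpJ x hx
  have hwc : ContinuousOn w (Ioo a b₀) :=
    (hFc.continuousOn.add continuousOn_const).div hpc.continuousOn hp0
  have hx₁ : (a + b₀) / 2 ∈ Ioo a b₀ := ⟨by linarith, by linarith⟩
  have hu_li : LocallyIntegrableOn u (Ioo a b₀) :=
    ((Lp.memLp (ξ : L2R)).locallyIntegrable (by norm_num)).locallyIntegrableOn _
  -- the weak first-order equation `p ξ′ = F + m` (tree, proof of Lemma 1.2) and du Bois-Reymond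
  have hweak : ∀ Θ : ℝ → ℝ, ContDiff ℝ ∞ Θ → HasCompactSupport Θ → tsupport Θ ⊆ Ioo a b₀ →
      ∫ x, ((deriv Θ x : ℝ) : ℂ) * u x = -∫ x, (Θ x : ℂ) * w x := fun Θ hΘ hΘc hΘs ↦
    integral_deriv_mul_eq_of_mem_prolateMax_c hab hpJ ξ hφ₂ hφ₂c hφ₂s hφ₂i hΘ hΘc hΘs
  obtain ⟨k, hk⟩ := ae_eq_primitive_add_const hab hu_li hwc hx₁ hweak
  set G : ℝ → ℂ := fun x ↦ (∫ t in (a + b₀) / 2..x, w t) + k with hG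
  have hGd : ∀ x ∈ Ioo a b₀, HasDerivAt G (w x) x := by
    intro x hx
    have hsub : uIcc ((a + b₀) / 2) x ⊆ Ioo a b₀ := fun y hy ↦
      ⟨lt_of_lt_of_le (lt_min hx₁.1 hx.1) hy.1, lt_of_le_of_lt hy.2 (max_lt hx₁.2 hx.2)⟩
    exact (intervalIntegral.integral_hasDerivAt_right ((hwc.mono hsub).intervalIntegrable)
      (hwc.stronglyMeasurableAtFilter isOpen_Ioo x hx)
      (hwc.continuousAt (isOpen_Ioo.mem_nhds hx))).add_const k
  have hGc : ContinuousOn G (Ioo a b₀) := fun x hx ↦ (hGd x hx).continuousAt.continuousWithinAt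
  -- `ξ = G` a.e. on the side interval
  have hae : ∀ᵐ x, x ∈ Ioo a b₀ → u x = G x := by
    filter_upwards [hk] with x hx hxJ using hx hxJ
  -- `F` has derivative `(q − z) G` on the side interval
  have hhae : h =ᵐ[volume] fun t ↦ (qCoeff lam t - z) * u t := h_ae_eq_of_eigen ξ hW
  have hFd : ∀ x ∈ Ioo a b₀, HasDerivAt F ((qCoeff lam x - z) * G x) x := by
    intro x hx
    -- near `x`, `F y = F x + ∫_x^y (q − z) G`
    set r : ℝ → ℂ := fun t ↦ (qCoeff lam t - z) * G t with hr
    have hrc : ContinuousOn r (Ioo a b₀) :=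
      (((continuous_qCoeff_def lam).continuousOn).sub continuousOn_const).mul hGc
    have hloc : ∀ y ∈ Ioo a b₀, F y = F x + ∫ t in x..y, r t := by
      intro y hy
      have hxy : uIcc x y ⊆ Ioo a b₀ := fun t ht ↦
        ⟨lt_of_lt_of_le (lt_min hx.1 hy.1) ht.1, lt_of_le_of_lt ht.2 (max_lt hx.2 hy.2)⟩
      have e1 : F y = F x + ∫ t in x..y, h t := by
        simp only [hF]
        rw [intervalIntegral.integral_add_adjacent_intervals (intervalIntegrable_h ξ a x)
          (intervalIntegrable_h ξ x y)]
      rw [e1]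
      congr 1
      refine intervalIntegral.integral_congr_ae ?_
      have h2 : ∀ᵐ t, t ∈ Ioo a b₀ → h t = r t := by
        filter_upwards [hhae, hae] with t h1 h3 ht
        rw [h1, hr]; simp only; rw [h3 ht]
      filter_upwards [h2] with t ht htI
      exact ht (hxy (uIoc_subset_uIcc htI))
    have hId : HasDerivAt (fun y ↦ F x + ∫ t in x..y, r t) (r x) x := by
      have hsub : uIcc x x ⊆ Ioo a b₀ := by rw [uIcc_self]; exact singleton_subset_iff.2 hx
      exact ((intervalIntegral.integral_hasDerivAt_right ((hrc.mono hsub).intervalIntegrable)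
        (hrc.stronglyMeasurableAtFilter isOpen_Ioo x hx)
        (hrc.continuousAt (isOpen_Ioo.mem_nhds hx))).const_add (F x))
    refine hId.congr_of_eventuallyEq ?_
    filter_upwards [isOpen_Ioo.mem_nhds hx] with y hy using hloc y hy
  -- the solution pair `(G, w)`
  refine ⟨G, w, hGd, fun x hx ↦ ?_, hae⟩
  have heq : (fun y ↦ pCoeff lam y * w y) =ᶠ[𝓝 x] fun y ↦ F y + m := by
    filter_upwards [isOpen_Ioo.mem_nhds hx] with y hy
    simp only [hw]
    field_simp [hp0 y hy]
  exact ((hFd x hx).add_const m).congr_of_eventuallyEq heq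

end EigenSideInterval

/-! ## §4. Classical representatives on the whole components -/

section Components

variable {lam : ℝ} {z : ℂ}

/-- Two continuous representatives of the same a.e. class agree on an open set, and so do the
derivative data of two solution pairs there. [folklore] -/
private theorem eqOn_of_ae_eq_of_continuousOn_c {V : Set ℝ} (hV : IsOpen V) {u g₁ g₂ : ℝ → ℂ}
    (h₁ : ∀ᵐ x, x ∈ V → u x = g₁ x) (h₂ : ∀ᵐ x, x ∈ V → u x = g₂ x)
    (hc₁ : ContinuousOn g₁ V) (hc₂ : ContinuousOn g₂ V) : EqOn g₁ g₂ V := by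
  refine Measure.eqOn_open_of_ae_eq (μ := volume) ?_ hV hc₁ hc₂
  rw [EventuallyEq, ae_restrict_iff' hV.measurableSet]
  filter_upwards [h₁, h₂] with x hx1 hx2 hx
  rw [← hx1 hx, hx2 hx]

/-- If two functions agree on a neighbourhood and have derivatives there, the derivatives agree.
[folklore] -/
private theorem deriv_data_eq_of_eqOn {V : Set ℝ} (hV : IsOpen V) {g₁ g₂ g₁' g₂' : ℝ → ℂ}
    (heq : EqOn g₁ g₂ V) (h₁ : ∀ x ∈ V, HasDerivAt g₁ (g₁' x) x) (h₂ : ∀ x ∈ V, HasDerivAt g₂ (g₂' x) x)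
    {x : ℝ} (hx : x ∈ V) : g₁' x = g₂' x :=
  ((h₁ x hx).congr_of_eventuallyEq (heq.eventuallyEq_of_mem (hV.mem_nhds hx)).symm).unique (h₂ x hx)
    |>.symm.symm

/-- **Classical representative on `(−λ, λ)`** of an eigenvector of `W_max`.
[cite: ConnesMoscovici2022, Lemma 1.1 proof (= arXiv Lemma 2.1, chunk p0004:L41–L44)] -/
theorem exists_sol_Ioo_ae_eq_of_eigen (hlam : 0 < lam) (ξ : (prolateMax lam).domain)
    (hW : prolateMax lam ξ = z • (ξ : L2R)) :
    ∃ g g' : ℝ → ℂ, (∀ x ∈ Ioo (-lam) lam, HasDerivAt g (g' x) x) ∧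
      (∀ x ∈ Ioo (-lam) lam, HasDerivAt (fun y ↦ pCoeff lam y * g' y) ((qCoeff lam x - z) * g x) x) ∧
      ∀ᵐ x, x ∈ Ioo (-lam) lam → ((ξ : L2R) : ℝ → ℂ) x = g x := by
  have hpJ : ∀ x ∈ Ioo (-lam) lam, lam ^ 2 - x ^ 2 ≠ 0 := fun x hx ↦ by
    have := Ioo_subset_setOf_ne_ne lam hx
    have h := pCoeff_ne_zero_iff.2 this
    unfold pCoeff at h; exact_mod_cast h
  exact exists_sol_ae_eq_of_eigen (by linarith) hpJ ξ hW

/-- **Classical representative on `(λ, ∞)`** of an eigenvector of `W_max` (side intervals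
`(λ, λ + n + 2)` patched by the uniqueness of part A).
[cite: ConnesMoscovici2022, Lemma 1.1 proof (= arXiv Lemma 2.1, chunk p0004:L41–L44)] -/
theorem exists_sol_Ioi_ae_eq_of_eigen (hlam : 0 < lam) (ξ : (prolateMax lam).domain)
    (hW : prolateMax lam ξ = z • (ξ : L2R)) :
    ∃ g g' : ℝ → ℂ, (∀ x ∈ Ioi lam, HasDerivAt g (g' x) x) ∧
      (∀ x ∈ Ioi lam, HasDerivAt (fun y ↦ pCoeff lam y * g' y) ((qCoeff lam x - z) * g x) x) ∧
      ∀ᵐ x, x ∈ Ioi lam → ((ξ : L2R) : ℝ → ℂ) x = g x := by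
  have hU := Ioi_subset_setOf_ne_ne hlam
  have hpJ : ∀ n : ℕ, ∀ x ∈ Ioo lam (lam + n + 2), lam ^ 2 - x ^ 2 ≠ 0 := fun n x hx ↦ by
    have h := pCoeff_ne_zero_iff.2 (hU hx.1)
    unfold pCoeff at h; exact_mod_cast h
  have hn : ∀ n : ℕ, lam < lam + n + 2 := fun n ↦ by
    have := n.cast_nonneg (α := ℝ); linarith
  choose gn gn' hgn hun haen using fun n : ℕ ↦ exists_sol_ae_eq_of_eigen (hn n) (hpJ n) ξ hW
  -- the global solution with the data of `g₀` at `x₀ = λ + 1`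
  set x₀ : ℝ := lam + 1 with hx₀
  have hx₀I : lam < x₀ := by rw [hx₀]; linarith
  obtain ⟨G, G', hG0, hG1, hGsol⟩ :=
    exists_sol_Ioi hlam z hx₀I (gn 0 x₀) (pCoeff lam x₀ * gn' 0 x₀)
  have hx₀n : ∀ n : ℕ, x₀ ∈ Ioo lam (lam + n + 2) := fun n ↦
    ⟨hx₀I, by rw [hx₀]; have := n.cast_nonneg (α := ℝ); linarith⟩
  -- each `gₙ` agrees with `G` on its side interval
  have hagree : ∀ n : ℕ, EqOn (gn n) G (Ioo lam (lam + n + 2)) := by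
    intro n
    -- `gₙ = g₀` on `(λ, λ + 2)`, hence the same data at `x₀`
    have hsub0 : Ioo lam (lam + (0 : ℕ) + 2) ⊆ Ioo lam (lam + n + 2) := Ioo_subset_Ioo le_rfl (by
      have := n.cast_nonneg (α := ℝ); push_cast; linarith)
    have hV : IsOpen (Ioo lam (lam + (0 : ℕ) + 2)) := isOpen_Ioo
    have heq0 : EqOn (gn n) (gn 0) (Ioo lam (lam + (0 : ℕ) + 2)) :=
      eqOn_of_ae_eq_of_continuousOn_c hV
        (by filter_upwards [haen n] with x hx hxV using hx (hsub0 hxV)) (haen 0)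
        (fun x hx ↦ (hgn n x (hsub0 hx)).continuousAt.continuousWithinAt)
        (fun x hx ↦ (hgn 0 x hx).continuousAt.continuousWithinAt)
    have hd0 : gn' n x₀ = gn' 0 x₀ :=
      deriv_data_eq_of_eqOn hV heq0 (fun x hx ↦ hgn n x (hsub0 hx)) (hgn 0) (hx₀n 0)
    have hsubU : Ioo lam (lam + n + 2) ⊆ {x : ℝ | x ≠ lam ∧ x ≠ -lam} := fun x hx ↦ hU hx.1
    exact (eqOn_of_sol_Ioo hsubU (hx₀n n) (hgn n) (hun n)
      (fun x hx ↦ (hGsol x hx.1).1) (fun x hx ↦ (hGsol x hx.1).2)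
      (by rw [hG0]; exact heq0 (hx₀n 0)) (by rw [hG1, hd0])).1
  refine ⟨G, G', fun x hx ↦ (hGsol x hx).1, fun x hx ↦ (hGsol x hx).2, ?_⟩
  have hall : ∀ᵐ x, ∀ n : ℕ, x ∈ Ioo lam (lam + n + 2) → ((ξ : L2R) : ℝ → ℂ) x = G x := by
    rw [ae_all_iff]
    intro n
    filter_upwards [haen n] with x hx hxn
    rw [hx hxn, hagree n hxn]
  filter_upwards [hall] with x hx hxI
  obtain ⟨n, hn'⟩ := exists_nat_gt (x - lam)
  exact hx n ⟨hxI, by linarith⟩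

/-- **Classical representative on `(−∞, −λ)`** of an eigenvector of `W_max`.
[cite: ConnesMoscovici2022, Lemma 1.1 proof (= arXiv Lemma 2.1, chunk p0004:L41–L44)] -/
theorem exists_sol_Iio_ae_eq_of_eigen (hlam : 0 < lam) (ξ : (prolateMax lam).domain)
    (hW : prolateMax lam ξ = z • (ξ : L2R)) :
    ∃ g g' : ℝ → ℂ, (∀ x ∈ Iio (-lam), HasDerivAt g (g' x) x) ∧
      (∀ x ∈ Iio (-lam), HasDerivAt (fun y ↦ pCoeff lam y * g' y) ((qCoeff lam x - z) * g x) x) ∧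
      ∀ᵐ x, x ∈ Iio (-lam) → ((ξ : L2R) : ℝ → ℂ) x = g x := by
  have hU := Iio_subset_setOf_ne_ne hlam
  have hpJ : ∀ n : ℕ, ∀ x ∈ Ioo (-lam - n - 2) (-lam), lam ^ 2 - x ^ 2 ≠ 0 := fun n x hx ↦ by
    have h := pCoeff_ne_zero_iff.2 (hU hx.2)
    unfold pCoeff at h; exact_mod_cast h
  have hn : ∀ n : ℕ, -lam - n - 2 < -lam := fun n ↦ by
    have := n.cast_nonneg (α := ℝ); linarith
  choose gn gn' hgn hun haen using fun n : ℕ ↦ exists_sol_ae_eq_of_eigen (hn n) (hpJ n) ξ hW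
  set x₀ : ℝ := -lam - 1 with hx₀
  have hx₀I : x₀ < -lam := by rw [hx₀]; linarith
  obtain ⟨G, G', hG0, hG1, hGsol⟩ :=
    exists_sol_Iio hlam z hx₀I (gn 0 x₀) (pCoeff lam x₀ * gn' 0 x₀)
  have hx₀n : ∀ n : ℕ, x₀ ∈ Ioo (-lam - n - 2) (-lam) := fun n ↦
    ⟨by rw [hx₀]; have := n.cast_nonneg (α := ℝ); linarith, hx₀I⟩
  have hagree : ∀ n : ℕ, EqOn (gn n) G (Ioo (-lam - n - 2) (-lam)) := by
    intro n
    have hsub0 : Ioo (-lam - (0 : ℕ) - 2) (-lam) ⊆ Ioo (-lam - n - 2) (-lam) := Ioo_subset_Ioo (by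
      have := n.cast_nonneg (α := ℝ); push_cast; linarith) le_rfl
    have hV : IsOpen (Ioo (-lam - (0 : ℕ) - 2) (-lam)) := isOpen_Ioo
    have heq0 : EqOn (gn n) (gn 0) (Ioo (-lam - (0 : ℕ) - 2) (-lam)) :=
      eqOn_of_ae_eq_of_continuousOn_c hV
        (by filter_upwards [haen n] with x hx hxV using hx (hsub0 hxV)) (haen 0)
        (fun x hx ↦ (hgn n x (hsub0 hx)).continuousAt.continuousWithinAt)
        (fun x hx ↦ (hgn 0 x hx).continuousAt.continuousWithinAt)
    have hd0 : gn' n x₀ = gn' 0 x₀ :=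
      deriv_data_eq_of_eqOn hV heq0 (fun x hx ↦ hgn n x (hsub0 hx)) (hgn 0) (hx₀n 0)
    have hsubU : Ioo (-lam - n - 2) (-lam) ⊆ {x : ℝ | x ≠ lam ∧ x ≠ -lam} := fun x hx ↦ hU hx.2
    exact (eqOn_of_sol_Ioo hsubU (hx₀n n) (hgn n) (hun n)
      (fun x hx ↦ (hGsol x hx.2).1) (fun x hx ↦ (hGsol x hx.2).2)
      (by rw [hG0]; exact heq0 (hx₀n 0)) (by rw [hG1, hd0])).1
  refine ⟨G, G', fun x hx ↦ (hGsol x hx).1, fun x hx ↦ (hGsol x hx).2, ?_⟩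
  have hall : ∀ᵐ x, ∀ n : ℕ, x ∈ Ioo (-lam - n - 2) (-lam) → ((ξ : L2R) : ℝ → ℂ) x = G x := by
    rw [ae_all_iff]
    intro n
    filter_upwards [haen n] with x hx hxn
    rw [hx hxn, hagree n hxn]
  filter_upwards [hall] with x hx hxI
  obtain ⟨n, hn'⟩ := exists_nat_gt (-lam - x)
  exact hx n ⟨by linarith, hxI⟩

end Components

/-! ## §5. The weak eigen-equation -/

section WeakEq

variable {lam : ℝ} {z : ℂ}

/-- **The weak eigen-equation**: if `W_max ξ = z ξ` then `∫ ξ · (Wθ − zθ) = 0` for every Schwartz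
`θ` ("`Dom(W_max) = {ξ ∈ L² | Wξ ∈ L²}` with `Wξ` viewed as a tempered distribution").
[cite: ConnesMoscovici2022, §1 eq. (1.2) (= arXiv (2.2), chunk p0004:L16–L22); Lemma 1.1 proof (chunk p0004:L41)] -/
theorem integral_mul_prolateWave_sub_eq_zero_of_eigen (ξ : (prolateMax lam).domain)
    (hW : prolateMax lam ξ = z • (ξ : L2R)) (θ : 𝓢(ℝ, ℂ)) :
    ∫ x, ((ξ : L2R) : ℝ → ℂ) x * (prolateWaveOpFun lam θ x - z * θ x) = 0 := by
  have h := integral_prolateSchwartz_mul_eq_c lam ξ θ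
  have h1 : ((prolateMax lam ξ : L2R) : ℝ → ℂ) =ᵐ[volume] fun t ↦ z * (ξ : L2R) t := by
    rw [hW]
    filter_upwards [Lp.coeFn_smul z (ξ : L2R)] with t ht
    rw [ht, Pi.smul_apply, smul_eq_mul]
  have h2 : ∫ x, θ x * (prolateMax lam ξ : L2R) x = ∫ x, θ x * (z * (ξ : L2R) x) :=
    integral_congr_ae (by filter_upwards [h1] with t ht; rw [ht])
  have hi1 : Integrable (fun x ↦ prolateSchwartz lam θ x * (ξ : L2R) x) :=
    ((prolateSchwartz lam θ).memLp 2 volume).integrable_mul (Lp.memLp (ξ : L2R))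
  have hi2 : Integrable (fun x ↦ θ x * (ξ : L2R) x) :=
    (θ.memLp 2 volume).integrable_mul (Lp.memLp (ξ : L2R))
  have e : (fun x ↦ ((ξ : L2R) : ℝ → ℂ) x * (prolateWaveOpFun lam θ x - z * θ x)) =
      fun x ↦ prolateSchwartz lam θ x * (ξ : L2R) x - z * (θ x * (ξ : L2R) x) := by
    funext x; rw [← prolateSchwartz_apply]; ring
  rw [e, integral_sub hi1 (hi2.const_mul z), integral_const_mul, h, h2]
  have e2 : (fun x ↦ θ x * (z * (ξ : L2R) x)) = fun x ↦ z * (θ x * (ξ : L2R) x) := by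
    funext x; ring
  rw [e2, integral_const_mul, sub_self]

end WeakEq

/-! ## §6. Green's identity on `ℝ` for a piecewise classical solution: the two jump terms -/

section Green

variable {lam : ℝ} {z : ℂ}

/-- **Improper FTC on a bounded interval with one-sided boundary limits**: if `f` is continuous on
`(a, b)` and interval integrable on `[a, b]`, `Φ′ = f` on `(a, b)`, `Φ → A` at `a⁺` and `Φ → B` at
`b⁻`, then `∫_a^b f = B − A`. [folklore] -/
private theorem intervalIntegral_eq_of_tendsto {a b : ℝ} (hab : a < b) {f Φ : ℝ → ℂ}
    (hfi : IntervalIntegrable f volume a b)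
    (hΦ : ∀ x ∈ Ioo a b, HasDerivAt Φ (f x) x) {A B : ℂ}
    (hA : Tendsto Φ (𝓝[>] a) (𝓝 A)) (hB : Tendsto Φ (𝓝[<] b) (𝓝 B)) :
    ∫ x in a..b, f x = B - A := by
  set P : ℝ → ℂ := fun t ↦ ∫ x in a..t, f x with hP
  have hPc : ContinuousOn P (Icc a b) := by
    have := intervalIntegral.continuousOn_primitive_interval' (μ := volume) hfi (a := a) left_mem_uIcc
    rwa [uIcc_of_le hab.le] at this
  have hIcc : ∀ {s t : ℝ}, s ∈ Ioo a b → t ∈ Ioo a b → uIcc s t ⊆ Ioo a b := fun hs ht x hx ↦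
    ⟨lt_of_lt_of_le (lt_min hs.1 ht.1) hx.1, lt_of_le_of_lt hx.2 (max_lt hs.2 ht.2)⟩
  have hii : ∀ {s t : ℝ}, s ∈ Icc a b → t ∈ Icc a b → IntervalIntegrable f volume s t :=
    fun hs ht ↦ hfi.mono_set (by rw [uIcc_of_le hab.le]; exact uIcc_subset_Icc hs ht)
  -- `Φ t − Φ s = P t − P s` inside
  set s₀ : ℝ := (a + b) / 2 with hs₀
  have hs₀I : s₀ ∈ Ioo a b := ⟨by rw [hs₀]; linarith, by rw [hs₀]; linarith⟩
  set K : ℂ := Φ s₀ - P s₀ with hK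
  have hΦP : ∀ t ∈ Ioo a b, Φ t = P t + K := by
    intro t ht
    have h1 : ∫ x in s₀..t, f x = Φ t - Φ s₀ :=
      intervalIntegral.integral_eq_sub_of_hasDerivAt (fun x hx ↦ hΦ x (hIcc hs₀I ht hx))
        (hii (Ioo_subset_Icc_self hs₀I) (Ioo_subset_Icc_self ht))
    have h2 : P t - P s₀ = ∫ x in s₀..t, f x := by
      simp only [hP]
      exact intervalIntegral.integral_interval_sub_left (hii (left_mem_Icc.2 hab.le) (Ioo_subset_Icc_self ht))
        (hii (left_mem_Icc.2 hab.le) (Ioo_subset_Icc_self hs₀I))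
    rw [hK]; linear_combination -h1 - h2
  -- limits of `P + K`
  have hPa : Tendsto P (𝓝[>] a) (𝓝 (P a)) :=
    (hPc a (left_mem_Icc.2 hab.le)).tendsto.mono_left
      (nhdsWithin_le_iff.mpr (mem_of_superset (Ioo_mem_nhdsGT hab) Ioo_subset_Icc_self))
  have hPb : Tendsto P (𝓝[<] b) (𝓝 (P b)) :=
    (hPc b (right_mem_Icc.2 hab.le)).tendsto.mono_left
      (nhdsWithin_le_iff.mpr (mem_of_superset (Ioo_mem_nhdsLT hab) Ioo_subset_Icc_self))
  have hA' : Tendsto Φ (𝓝[>] a) (𝓝 (P a + K)) :=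
    (hPa.add tendsto_const_nhds).congr' (by
      filter_upwards [Ioo_mem_nhdsGT hab] with t ht using (hΦP t ht).symm)
  have hB' : Tendsto Φ (𝓝[<] b) (𝓝 (P b + K)) :=
    (hPb.add tendsto_const_nhds).congr' (by
      filter_upwards [Ioo_mem_nhdsLT hab] with t ht using (hΦP t ht).symm)
  have hPa0 : P a = 0 := by simp [hP]
  have eA : A = K := by have := tendsto_nhds_unique hA hA'; rw [this, hPa0, zero_add]
  have eB : B = P b + K := tendsto_nhds_unique hB hB'
  change P b = B - A
  rw [eA, eB]; ring

/-- **Improper FTC on `[s, ∞)`**: `∫_{(s, ∞)} f = −Φ(s)` when `Φ′ = f` on `(a, ∞) ∋ s`, `f`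
continuous and integrable there, and `Φ → 0` at `+∞`. [folklore] -/
private theorem integral_Ioi_eq_neg_of_tendsto {a s : ℝ} (hs : a < s) {f Φ : ℝ → ℂ}
    (hfc : ContinuousOn f (Ioi a)) (hfi : IntegrableOn f (Ioi a))
    (hΦ : ∀ x ∈ Ioi a, HasDerivAt Φ (f x) x) (h0 : Tendsto Φ atTop (𝓝 0)) :
    ∫ x in Ioi s, f x = -Φ s := by
  have h1 : Tendsto (fun t ↦ ∫ x in s..t, f x) atTop (𝓝 (∫ x in Ioi s, f x)) :=
    intervalIntegral_tendsto_integral_Ioi s (hfi.mono_set (Ioi_subset_Ioi hs.le)) tendsto_id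
  have h2 : Tendsto (fun t ↦ ∫ x in s..t, f x) atTop (𝓝 (0 - Φ s)) := by
    refine (h0.sub tendsto_const_nhds).congr' ?_
    filter_upwards [eventually_ge_atTop s] with t hst
    have hsub : uIcc s t ⊆ Ioi a := by
      rw [uIcc_of_le hst]; exact fun x hx ↦ lt_of_lt_of_le hs hx.1
    exact (intervalIntegral.integral_eq_sub_of_hasDerivAt (fun x hx ↦ hΦ x (hsub hx))
      ((hfc.mono hsub).intervalIntegrable)).symm
  rw [tendsto_nhds_unique h1 h2, zero_sub]

/-- **Improper FTC on `(−∞, s]`**: `∫_{(−∞, s]} f = Φ(s)` when `Φ′ = f` on `(−∞, b) ∋ s`, `f`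
continuous and integrable there, and `Φ → 0` at `−∞`. [folklore] -/
private theorem integral_Iic_eq_of_tendsto {b s : ℝ} (hs : s < b) {f Φ : ℝ → ℂ}
    (hfc : ContinuousOn f (Iio b)) (hfi : IntegrableOn f (Iio b))
    (hΦ : ∀ x ∈ Iio b, HasDerivAt Φ (f x) x) (h0 : Tendsto Φ atBot (𝓝 0)) :
    ∫ x in Iic s, f x = Φ s := by
  have h1 : Tendsto (fun t ↦ ∫ x in t..s, f x) atBot (𝓝 (∫ x in Iic s, f x)) :=
    intervalIntegral_tendsto_integral_Iic s (hfi.mono_set (Iic_subset_Iio.2 hs)) tendsto_id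
  have h2 : Tendsto (fun t ↦ ∫ x in t..s, f x) atBot (𝓝 (Φ s - 0)) := by
    refine (tendsto_const_nhds.sub h0).congr' ?_
    filter_upwards [eventually_le_atBot s] with t hts
    have hsub : uIcc t s ⊆ Iio b := by
      rw [uIcc_of_le hts]; exact fun x hx ↦ lt_of_le_of_lt hx.2 hs
    exact (intervalIntegral.integral_eq_sub_of_hasDerivAt (fun x hx ↦ hΦ x (hsub hx))
      ((hfc.mono hsub).intervalIntegrable)).symm
  rw [tendsto_nhds_unique h1 h2, sub_zero]

/-- A Schwartz function times `p = λ² − x²` (a function of temperate growth) tends to `0` at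
`±∞` (it is again a Schwartz function). [folklore] -/
private theorem tendsto_pCoeff_mul_schwartz_cocompact (lam : ℝ) (θ : 𝓢(ℝ, ℂ)) :
    Tendsto (fun x ↦ pCoeff lam x * θ x) (cocompact ℝ) (𝓝 0) := by
  have h := ZeroAtInftyContinuousMapClass.zero_at_infty (smulLeftCLM ℂ (pCoeff lam) θ)
  refine h.congr fun x ↦ ?_
  rw [smulLeftCLM_apply_apply (pCoeff_hasTemperateGrowth lam), smul_eq_mul]

/-- `deriv θ` of a Schwartz map is (the underlying function of) the Schwartz map `derivCLM θ`. [folklore] -/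
private theorem deriv_schwartz_eq (θ : 𝓢(ℝ, ℂ)) : deriv (θ : ℝ → ℂ) = ⇑(derivCLM ℂ ℂ θ) := by
  funext x; rw [derivCLM_apply]

/-- Bounded times vanishing: if `‖u x‖ ≤ C` eventually along `l` and `v → 0` along `l`, then
`u v → 0`. [folklore] -/
private theorem tendsto_mul_zero_of_bounded {l : Filter ℝ} {u v : ℝ → ℂ} {C : ℝ}
    (hu : ∀ᶠ x in l, ‖u x‖ ≤ C) (hv : Tendsto v l (𝓝 0)) :
    Tendsto (fun x ↦ u x * v x) l (𝓝 0) := by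
  have hC : ∀ᶠ x in l, ‖u x * v x‖ ≤ max C 0 * ‖v x‖ := by
    filter_upwards [hu] with x hx
    rw [norm_mul]
    exact mul_le_mul_of_nonneg_right (hx.trans (le_max_left _ _)) (norm_nonneg _)
  refine squeeze_zero_norm' hC ?_
  have := hv.norm.const_mul (max C 0)
  simpa using this

/-- **The Lagrange identity behind Green's formula**: along a solution pair of `(p g′)′ = (q − z) g`
and a Schwartz `θ`, `Φ = θ · (p g′) − g · (p θ′)` has derivative `g · (Wθ − zθ)`.
[cite: ConnesMoscovici2022, §1 eqs. (1.5)–(1.6) (= arXiv (2.5)–(2.6), chunk p0005:L24–L31)] -/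
theorem hasDerivAt_green_boundary (θ : 𝓢(ℝ, ℂ)) {g g' : ℝ → ℂ} {x : ℝ}
    (hg : HasDerivAt g (g' x) x)
    (hu : HasDerivAt (fun y ↦ pCoeff lam y * g' y) ((qCoeff lam x - z) * g x) x) :
    HasDerivAt (fun y ↦ θ y * (pCoeff lam y * g' y) - g y * (pCoeff lam y * deriv θ y))
      (g x * (prolateWaveOpFun lam θ x - z * θ x)) x := by
  have hθ : HasDerivAt (θ : ℝ → ℂ) (deriv θ x) x := θ.differentiableAt.hasDerivAt
  have hdθ : DifferentiableAt ℝ (deriv (θ : ℝ → ℂ)) x := by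
    rw [deriv_schwartz_eq]; exact (derivCLM ℂ ℂ θ).differentiableAt
  have hp : DifferentiableAt ℝ (pCoeff lam) x := (hasDerivAt_pCoeff_def lam x).differentiableAt
  have hpθ : HasDerivAt (fun y ↦ pCoeff lam y * deriv θ y)
      (deriv (fun y ↦ pCoeff lam y * deriv θ y) x) x := (hp.mul hdθ).hasDerivAt
  have h := (hθ.mul hu).sub (hg.mul hpθ)
  refine h.congr_deriv ?_
  have eP : (fun y ↦ ((lam ^ 2 - y ^ 2 : ℝ) : ℂ) * deriv θ y) = fun y ↦ pCoeff lam y * deriv θ y := by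
    funext y; rfl
  simp only [prolateWaveOpFun, eP, qCoeff]
  push_cast
  ring

/-- The boundary term `Φ = θ · (p g′) − g · (p θ′)` at a finite singular point `a` (`a² = λ²`):
if `p g′ → c` and `(x − a) g → 0` along a one-sided filter at `a`, then `Φ → θ(a) c`.
[cite: ConnesMoscovici2022, Lemma 1.1 proof "the logarithmic singularities … have to match" (= arXiv Lemma 2.1, chunk p0004:L44–L46)] -/
theorem tendsto_green_boundary_finite (θ : 𝓢(ℝ, ℂ)) {g g' : ℝ → ℂ} {a : ℝ} (ha : a ^ 2 = lam ^ 2)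
    {l : Filter ℝ} (hl : l ≤ 𝓝 a) {c : ℂ}
    (hc : Tendsto (fun x ↦ pCoeff lam x * g' x) l (𝓝 c))
    (h0 : Tendsto (fun x ↦ ((x - a : ℝ) : ℂ) * g x) l (𝓝 0)) :
    Tendsto (fun y ↦ θ y * (pCoeff lam y * g' y) - g y * (pCoeff lam y * deriv θ y)) l
      (𝓝 (θ a * c)) := by
  have hθ : Tendsto (θ : ℝ → ℂ) l (𝓝 (θ a)) := (θ.continuous.tendsto a).mono_left hl
  have hθ' : Tendsto (fun x ↦ -((x + a : ℝ) : ℂ) * deriv θ x) l (𝓝 (-((a + a : ℝ) : ℂ) * deriv θ a)) := by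
    have hc1 : Continuous fun x : ℝ ↦ -((x + a : ℝ) : ℂ) * deriv θ x := by
      rw [deriv_schwartz_eq]
      exact ((Complex.continuous_ofReal.comp (by fun_prop)).neg).mul (derivCLM ℂ ℂ θ).continuous
    exact (hc1.tendsto a).mono_left hl
  -- `p θ′ g = ((x − a) g) · (−(x + a) θ′)`
  have h2 : Tendsto (fun x ↦ ((x - a : ℝ) : ℂ) * g x * (-((x + a : ℝ) : ℂ) * deriv θ x)) l (𝓝 0) := by
    have := h0.mul hθ'
    rw [zero_mul] at this
    exact this
  have e : ∀ x, g x * (pCoeff lam x * deriv θ x) =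
      ((x - a : ℝ) : ℂ) * g x * (-((x + a : ℝ) : ℂ) * deriv θ x) := by
    intro x
    have hp : pCoeff lam x = ((x - a : ℝ) : ℂ) * (-((x + a : ℝ) : ℂ)) := by
      unfold pCoeff; rw [← ha]; push_cast; ring
    rw [hp]; ring
  have h3 := (hθ.mul hc).sub h2
  rw [sub_zero] at h3
  exact h3.congr fun x ↦ by rw [e]

/-- The boundary term vanishes at `±∞` when `g, g′` are bounded near infinity (`p θ` and `p θ′`
are Schwartz functions). [cite: ConnesMoscovici2022, Lemma 1.1 proof (= arXiv Lemma 2.1, chunk p0004:L44–L48)] -/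
theorem tendsto_green_boundary_cocompact (θ : 𝓢(ℝ, ℂ)) {g g' : ℝ → ℂ} {C R : ℝ}
    (hb : ∀ x, R ≤ |x| → ‖g x‖ ≤ C ∧ ‖g' x‖ ≤ C) {l : Filter ℝ} (hl : l ≤ cocompact ℝ)
    (hR : ∀ᶠ x in l, R ≤ |x|) :
    Tendsto (fun y ↦ θ y * (pCoeff lam y * g' y) - g y * (pCoeff lam y * deriv θ y)) l (𝓝 0) := by
  have h1 : Tendsto (fun x ↦ g' x * (pCoeff lam x * θ x)) l (𝓝 0) :=
    tendsto_mul_zero_of_bounded (C := C) (by filter_upwards [hR] with x hx using (hb x hx).2)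
      ((tendsto_pCoeff_mul_schwartz_cocompact lam θ).mono_left hl)
  have h2 : Tendsto (fun x ↦ g x * (pCoeff lam x * deriv θ x)) l (𝓝 0) := by
    have h := tendsto_mul_zero_of_bounded (C := C) (by filter_upwards [hR] with x hx using (hb x hx).1)
      ((tendsto_pCoeff_mul_schwartz_cocompact lam (derivCLM ℂ ℂ θ)).mono_left hl)
    refine h.congr fun x ↦ ?_
    rw [derivCLM_apply]
  have := h1.sub h2
  rw [sub_zero] at this
  exact this.congr fun x ↦ by ring

/-- **Green's identity on `ℝ` with the two jump terms.** Let `g` be a classical solution pair of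
`(p g′)′ = (q − z) g` off `±λ`, square integrable, with `g, g′` bounded near `±∞`, one-sided limits
`c` of `p g′` at `±λ` and `(x ∓ λ) g → 0` there (every classical solution has these properties — the
four singular points are limit circle; see `UVProlateDeficiencyEndpoints.lean`).  Then for every
Schwartz `θ`:
`∫ g · (Wθ − zθ) = θ(λ) (c_{λ⁻} − c_{λ⁺}) + θ(−λ) (c_{−λ⁻} − c_{−λ⁺})`
— the distribution `(W − z) g` is the sum of the two jumps of `p g′` times Dirac masses, so it
vanishes (i.e. `g ∈ Dom W_max` with `W g = z g`) iff "the logarithmic singularities of `ξ` on the left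
and the right of `±λ` match".
[cite: ConnesMoscovici2022, Lemma 1.1 proof (= arXiv Lemma 2.1, chunk p0004:L44–L48); §1 eqs. (1.5)–(1.6) (= arXiv (2.5)–(2.6))] -/
theorem integral_mul_prolateWave_sub_eq_jumps (hlam : 0 < lam) (θ : 𝓢(ℝ, ℂ)) {g g' : ℝ → ℂ}
    (hg : ∀ x ∈ {x : ℝ | x ≠ lam ∧ x ≠ -lam}, HasDerivAt g (g' x) x)
    (hu : ∀ x ∈ {x : ℝ | x ≠ lam ∧ x ≠ -lam},
      HasDerivAt (fun y ↦ pCoeff lam y * g' y) ((qCoeff lam x - z) * g x) x)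
    (hL2 : MemLp g 2 volume) {C R : ℝ} (hb : ∀ x, R ≤ |x| → ‖g x‖ ≤ C ∧ ‖g' x‖ ≤ C)
    {clm clp cmm cmp : ℂ}
    (hlm : Tendsto (fun x ↦ pCoeff lam x * g' x) (𝓝[<] lam) (𝓝 clm))
    (hlp : Tendsto (fun x ↦ pCoeff lam x * g' x) (𝓝[>] lam) (𝓝 clp))
    (hmm : Tendsto (fun x ↦ pCoeff lam x * g' x) (𝓝[<] (-lam)) (𝓝 cmm))
    (hmp : Tendsto (fun x ↦ pCoeff lam x * g' x) (𝓝[>] (-lam)) (𝓝 cmp))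
    (h0lm : Tendsto (fun x ↦ ((x - lam : ℝ) : ℂ) * g x) (𝓝[<] lam) (𝓝 0))
    (h0lp : Tendsto (fun x ↦ ((x - lam : ℝ) : ℂ) * g x) (𝓝[>] lam) (𝓝 0))
    (h0mm : Tendsto (fun x ↦ ((x - -lam : ℝ) : ℂ) * g x) (𝓝[<] (-lam)) (𝓝 0))
    (h0mp : Tendsto (fun x ↦ ((x - -lam : ℝ) : ℂ) * g x) (𝓝[>] (-lam)) (𝓝 0)) :
    ∫ x, g x * (prolateWaveOpFun lam θ x - z * θ x) =
      θ lam * (clm - clp) + θ (-lam) * (cmm - cmp) := by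
  set U : Set ℝ := {x : ℝ | x ≠ lam ∧ x ≠ -lam} with hUdef
  set f : ℝ → ℂ := fun x ↦ g x * (prolateWaveOpFun lam θ x - z * θ x) with hf
  set Φ : ℝ → ℂ := fun y ↦ θ y * (pCoeff lam y * g' y) - g y * (pCoeff lam y * deriv θ y) with hΦ
  have hΦd : ∀ x ∈ U, HasDerivAt Φ (f x) x := fun x hx ↦ hasDerivAt_green_boundary θ (hg x hx) (hu x hx)
  -- `f` is integrable (`g ∈ L²`, `Wθ − zθ` Schwartz) and continuous on `U`
  have hWθ : ∀ x, prolateWaveOpFun lam θ x - z * θ x = (prolateSchwartz lam θ - z • θ) x := fun x ↦ by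
    rw [sub_apply, smul_apply, prolateSchwartz_apply, smul_eq_mul]
  have hfi : Integrable f := by
    have := hL2.integrable_mul ((prolateSchwartz lam θ - z • θ).memLp 2 volume)
    exact this.congr (Eventually.of_forall fun x ↦ by simp only [hf, Pi.mul_apply, hWθ])
  have hgc : ContinuousOn g U := fun x hx ↦ (hg x hx).continuousAt.continuousWithinAt
  have hfc : ContinuousOn f U := by
    have hc : Continuous fun x ↦ prolateWaveOpFun lam θ x - z * θ x := by
      have : (fun x ↦ prolateWaveOpFun lam θ x - z * θ x) = ⇑(prolateSchwartz lam θ - z • θ) :=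
        funext hWθ
      rw [this]; exact (prolateSchwartz lam θ - z • θ).continuous
    exact hgc.mul hc.continuousOn
  -- the three components inside `U`
  have hIoi : Ioi lam ⊆ U := Ioi_subset_setOf_ne_ne hlam
  have hIio : Iio (-lam) ⊆ U := Iio_subset_setOf_ne_ne hlam
  have hIoo : Ioo (-lam) lam ⊆ U := Ioo_subset_setOf_ne_ne lam
  -- boundary limits of `Φ`
  have hsq : (-lam) ^ 2 = lam ^ 2 := by ring
  have hΦlm : Tendsto Φ (𝓝[<] lam) (𝓝 (θ lam * clm)) :=
    tendsto_green_boundary_finite θ rfl nhdsWithin_le_nhds hlm h0lm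
  have hΦlp : Tendsto Φ (𝓝[>] lam) (𝓝 (θ lam * clp)) :=
    tendsto_green_boundary_finite θ rfl nhdsWithin_le_nhds hlp h0lp
  have hΦmm : Tendsto Φ (𝓝[<] (-lam)) (𝓝 (θ (-lam) * cmm)) :=
    tendsto_green_boundary_finite θ hsq nhdsWithin_le_nhds hmm h0mm
  have hΦmp : Tendsto Φ (𝓝[>] (-lam)) (𝓝 (θ (-lam) * cmp)) :=
    tendsto_green_boundary_finite θ hsq nhdsWithin_le_nhds hmp h0mp
  have hΦtop : Tendsto Φ atTop (𝓝 0) :=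
    tendsto_green_boundary_cocompact θ hb atTop_le_cocompact (by
      filter_upwards [eventually_ge_atTop R] with x hx using hx.trans (le_abs_self x))
  have hΦbot : Tendsto Φ atBot (𝓝 0) :=
    tendsto_green_boundary_cocompact θ hb atBot_le_cocompact (by
      filter_upwards [eventually_le_atBot (-R)] with x hx
      have : R ≤ -x := by linarith
      exact this.trans (neg_le_abs x))
  -- the cut points `±x₁`, `x₁ = λ + 1`
  set x₁ : ℝ := lam + 1 with hx₁
  have hx₁l : lam < x₁ := by rw [hx₁]; linarith
  have hx₁m : -x₁ < -lam := by rw [hx₁]; linarith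
  have hx₁U : x₁ ∈ U := hIoi hx₁l
  have hx₁U' : -x₁ ∈ U := hIio hx₁m
  -- (1) `∫_{Iic (−x₁)} f = Φ(−x₁)` and `∫_{Ioi x₁} f = −Φ(x₁)`
  have hI1 : ∫ x in Iic (-x₁), f x = Φ (-x₁) :=
    integral_Iic_eq_of_tendsto hx₁m (hfc.mono hIio) hfi.integrableOn
      (fun x hx ↦ hΦd x (hIio hx)) hΦbot
  have hI5 : ∫ x in Ioi x₁, f x = -Φ x₁ :=
    integral_Ioi_eq_neg_of_tendsto hx₁l (hfc.mono hIoi) hfi.integrableOn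
      (fun x hx ↦ hΦd x (hIoi hx)) hΦtop
  -- (2) the three bounded pieces
  have hΦc : ∀ x ∈ U, ContinuousAt Φ x := fun x hx ↦ (hΦd x hx).continuousAt
  have hI2 : ∫ x in (-x₁)..(-lam), f x = θ (-lam) * cmm - Φ (-x₁) :=
    intervalIntegral_eq_of_tendsto hx₁m (hfi.intervalIntegrable)
      (fun x hx ↦ hΦd x (hIio hx.2)) ((hΦc _ hx₁U').tendsto.mono_left nhdsWithin_le_nhds) hΦmm
  have hI3 : ∫ x in (-lam)..lam, f x = θ lam * clm - θ (-lam) * cmp :=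
    intervalIntegral_eq_of_tendsto (by linarith) (hfi.intervalIntegrable)
      (fun x hx ↦ hΦd x (hIoo hx)) hΦmp hΦlm
  have hI4 : ∫ x in lam..x₁, f x = Φ x₁ - θ lam * clp :=
    intervalIntegral_eq_of_tendsto hx₁l (hfi.intervalIntegrable)
      (fun x hx ↦ hΦd x (hIoi hx.1)) hΦlp ((hΦc _ hx₁U).tendsto.mono_left nhdsWithin_le_nhds)
  -- (3) assemble
  have hsplit1 : (∫ x in Iic (-x₁), f x) + ∫ x in Ioi (-x₁), f x = ∫ x, f x :=
    intervalIntegral.integral_Iic_add_Ioi hfi.integrableOn hfi.integrableOn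
  have hsplit2 : (∫ x in (-x₁)..x₁, f x) + ∫ x in Ioi x₁, f x = ∫ x in Ioi (-x₁), f x :=
    intervalIntegral.integral_interval_add_Ioi hfi.integrableOn hfi.integrableOn
  have hsplit3 : ∫ x in (-x₁)..x₁, f x =
      (∫ x in (-x₁)..(-lam), f x) + ((∫ x in (-lam)..lam, f x) + ∫ x in lam..x₁, f x) := by
    rw [intervalIntegral.integral_add_adjacent_intervals hfi.intervalIntegrable hfi.intervalIntegrable,
      intervalIntegral.integral_add_adjacent_intervals hfi.intervalIntegrable hfi.intervalIntegrable]
  change ∫ x, f x = _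
  rw [← hsplit1, ← hsplit2, hsplit3, hI1, hI2, hI3, hI4, hI5]
  ring

end Green

/-! ## §7. Conversely: a square-integrable distributional solution is an eigenvector of `W_max` -/

section Converse

variable {lam : ℝ} {z : ℂ}

/-- **Distributional solutions are eigenvectors of `W_max`.** If `ξ ∈ L²(ℝ)` satisfies
`∫ ξ · (Wθ − zθ) = 0` for every Schwartz `θ`, then `ξ ∈ Dom W_max` and `W_max ξ = z ξ`, i.e. `ξ` lies
in the `z`-eigenspace of `W_max` ("`Dom(W_max) = {ξ ∈ L² | Wξ ∈ L²}` with `Wξ` viewed as a tempered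
distribution"; Mathlib: `LinearPMap.mem_adjoint_domain_of_exists`, `adjoint_apply_eq`, reality of `W`).
[cite: ConnesMoscovici2022, §1 eq. (1.2) (= arXiv (2.2), chunk p0004:L16–L22); Lemma 1.1 proof "any solution … belongs to Dom(W_max)" (chunk p0004:L46–L48)] -/
theorem mem_eigenspace_of_integral_eq_zero (ξ : L2R)
    (h : ∀ θ : 𝓢(ℝ, ℂ), ∫ x, (ξ : ℝ → ℂ) x * (prolateWaveOpFun lam θ x - z * θ x) = 0) :
    ξ ∈ (prolateMax lam).eigenspace z := by
  -- the adjoint pairing `⟪z ξ, φ⟫ = ⟪ξ, W φ⟫` on the core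
  have key : ∀ x : (prolateCore lam).domain,
      ⟪z • ξ, (x : L2R)⟫_ℂ = ⟪ξ, prolateCore lam x⟫_ℂ := by
    rintro ⟨x, hx⟩
    obtain ⟨φ, rfl⟩ := (LinearMap.mem_range).1 hx
    rw [prolateCore_apply]
    -- both sides as integrals
    set φc : 𝓢(ℝ, ℂ) := SchwartzMap.postcompCLM (Complex.conjCLE : ℂ →L[ℝ] ℂ) φ with hφc
    have hφc_apply : ∀ y, φc y = star (φ y) := fun y ↦ rfl
    have h1 : ⟪z • ξ, (schwartzToL2 φ : L2R)⟫_ℂ = (starRingEnd ℂ) z * ∫ y, star ((ξ : ℝ → ℂ) y) * φ y := by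
      rw [inner_smul_left, L2.inner_def]
      congr 1
      refine integral_congr_ae ?_
      filter_upwards [φ.coeFn_toLp 2 volume] with y hy
      change ⟪(ξ : ℝ → ℂ) y, ((φ.toLp 2 volume : L2R) : ℝ → ℂ) y⟫_ℂ = _
      rw [hy, RCLike.inner_apply, mul_comm]; rfl
    have h2 : ⟪ξ, (schwartzToL2 (prolateSchwartz lam φ) : L2R)⟫_ℂ =
        ∫ y, star ((ξ : ℝ → ℂ) y) * prolateWaveOpFun lam φ y := by
      rw [L2.inner_def]
      refine integral_congr_ae ?_
      filter_upwards [(prolateSchwartz lam φ).coeFn_toLp 2 volume] with y hy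
      change ⟪(ξ : ℝ → ℂ) y, (((prolateSchwartz lam φ).toLp 2 volume : L2R) : ℝ → ℂ) y⟫_ℂ = _
      rw [hy, RCLike.inner_apply, prolateSchwartz_apply, mul_comm]; rfl
    rw [h1, h2]
    -- use the hypothesis with `θ = φ̄`
    have h3 := h φc
    have hW' : ∀ y, prolateWaveOpFun lam φc y = conj (prolateWaveOpFun lam φ y) := fun y ↦ by
      rw [show (⇑φc : ℝ → ℂ) = fun t ↦ star (φ t) from funext hφc_apply, prolateWaveOpFun_star]; rfl
    have hi1 : Integrable (fun y ↦ (ξ : ℝ → ℂ) y * conj (prolateWaveOpFun lam φ y)) := by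
      have := (Lp.memLp ξ).integrable_mul ((prolateSchwartz lam φc).memLp 2 volume)
      refine this.congr (Eventually.of_forall fun y ↦ ?_)
      simp only [Pi.mul_apply, prolateSchwartz_apply, hW']
    have hi2 : Integrable (fun y ↦ (ξ : ℝ → ℂ) y * conj (φ y)) := by
      have := (Lp.memLp ξ).integrable_mul (φc.memLp 2 volume)
      refine this.congr (Eventually.of_forall fun y ↦ ?_)
      simp only [Pi.mul_apply, hφc_apply]; rfl
    have e3 : (fun y ↦ (ξ : ℝ → ℂ) y * (prolateWaveOpFun lam φc y - z * φc y)) =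
        fun y ↦ (ξ : ℝ → ℂ) y * conj (prolateWaveOpFun lam φ y) - z * ((ξ : ℝ → ℂ) y * conj (φ y)) := by
      funext y; rw [hW', hφc_apply, show star (φ y) = conj (φ y) from rfl]; ring
    rw [e3, integral_sub hi1 (hi2.const_mul z), integral_const_mul] at h3
    -- `h3 : A′ − z B′ = 0`; conjugate: `conj A′ = ∫ conj ξ · Wφ`, `conj B′ = ∫ conj ξ · φ`
    have h4 := congrArg conj (sub_eq_zero.1 h3)
    rw [map_mul, ← integral_conj, ← integral_conj] at h4
    simp only [map_mul, Complex.conj_conj] at h4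
    -- h4 : ∫ conj ξ * Wφ = conj z * ∫ conj ξ * φ
    have e5 : (fun y ↦ (starRingEnd ℂ) ((ξ : ℝ → ℂ) y) * prolateWaveOpFun lam φ y) =
        fun y ↦ star ((ξ : ℝ → ℂ) y) * prolateWaveOpFun lam φ y := rfl
    have e6 : (fun y ↦ (starRingEnd ℂ) ((ξ : ℝ → ℂ) y) * φ y) =
        fun y ↦ star ((ξ : ℝ → ℂ) y) * φ y := rfl
    rw [e5, e6] at h4
    rw [h4]
  have hmem : ξ ∈ (prolateMax lam).domain :=
    LinearPMap.mem_adjoint_domain_of_exists ξ ⟨z • ξ, key⟩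
  rw [LinearPMap.mem_eigenspace_iff]
  exact ⟨hmem, LinearPMap.adjoint_apply_eq dense_schwartzL2 ⟨ξ, hmem⟩ key⟩

end Converse

end Literature.NumberTheory.ConnesMoscovici2022

end
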